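import Mathlib.Logic.Equiv.Option
import Literature.Combinatorics.Additive.RelativeSzemerediCutNorm
import HarnessLib

/-!
# Conlon–Fox–Zhao: proof of the relative simplex counting lemma (Theorem 6.5)

Topic `Literature/Combinatorics/Additive`. Source: D. Conlon, J. Fox, Y. Zhao, *The Green–Tao
theorem: an exposition*, EMS Surv. Math. Sci. 1 (2014), 249–282 = arXiv:1403.2957 (held as
`paper:arxiv-1403.2957`; numbers are those of the arXiv version), §6 "Counting lemma". This file
DISCHARGES the named fact `Literature.Combinatorics.Additive.CFZ.RelativeCounting` (Theorem 6.5, file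
`RelativeSzemerediCutNorm.lean`):

* `CFZ.relativeCounting_holds : CFZ.RelativeCounting`.

The source proves the graph case (Thm. 6.2) in full and says of Thm. 6.5: "The proof … is a
straightforward generalization … We simply point out the necessary modifications and leave the
reader to figure out the details (a full proof can be found in our paper [GAFA 25 (2015)])". This
file carries out exactly the printed strategy for `(k-1)`-uniform `k`-partite weighted
hypergraphs `(ν_{-j}, g_{-j}, g̃_{-j})_j` on `X^k` (all parts equal, the convention of
`RelativeSzemerediCutNorm.lean`):

* **Dense counting** (Prop. 6.1 for simplices, "when `ν = 1` … the proof of Proposition 6.1 easily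
  extends"): `CFZ.dense_counting`, by telescoping; the passage from `{0,1}`-valued cuts to
  `[0,1]`-valued decorations ("the extrema occur when `a` and `b` are `{0,1}`-valued") is
  `CFZ.exists_indicator_round` / `CFZ.abs_expect_mul_prod_le`, and the conditioning on the
  remaining vertex ("the expectation has the form (6.1) if we fix any value of `z`") is
  `CFZ.abs_expect_mul_prod_erase_le`.
* **Linear forms, sub-products** (`CFZ.LFCWithin.general`): every product of distinct factors
  `ν_{-j}(x^{(ω)}_{-j})` and `1`'s averages to `1 + O(δ)`; used for `𝔼 ν_{-a} = 1 + O(δ)`,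
  `𝔼 ν' = 1 + O(δ)`, `𝔼 ν'² = 1 + O(δ)` ((6.4): `CFZ.abs_expect_dens_sub_one_le`,
  `CFZ.expect_dens_sq_le`) and inside the strong linear forms estimate.
* **Densification** (`CFZ.dens a G = 𝔼_{x_a} ∏_{j ≠ a} G_j`, the `ν', g', g̃'` of the source) and
  the identity `𝔼[∏ g] = 𝔼[g_{-a} g']` (`CFZ.expect_prod_eq_expect_mul_dens`, (6.2)).
* **Strong linear forms** (Lemma 6.4 for simplices, "we have to apply the Cauchy–Schwarz
  inequality `k-1` times in succession"): `CFZ.slf`,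
  `|𝔼[(ν_{-a} - 1) h' h'']|^{2^{k-1}} ≤ 4^{2^{k-1}} δ` for densified products `h', h''` of functions
  majorised by `ν` or by `1`. The `k - 1` Cauchy–Schwarz steps are taken in the packaged form of
  the weighted generalised von Neumann inequality of Green–Tao (2010), Cor. B.4 — the tree's
  `Literature.NumberTheory.Sieve.weightedGvN` — applied on the index type `Option ι` (the extra coordinate `none` carrying
  the second copy `u'` of `x_a`) to the family `CFZ.slfFam` (`ν_{-a} - 1` on the top cube
  `{some j : j ≠ a}`, `h_j(x|_{a:=u}) h'_j(x|_{a:=u'})` on the face missing `some j`, `1` below);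
  the resulting weighted box powers are linear-forms averages after the change of variables
  `CFZ.thetaEquiv` (`CFZ.slf_term1`: the alternating expansion of `∏_ω (ν_{-a}(x^{(ω)}) - 1)`,
  "the signs make all the `1`'s cancel"; `CFZ.slf_term2`: the faces).
* **The induction** ("on the number of `ν_{-1}, …, ν_{-k}` which are not identically `1`"):
  `CFZ.CountingInd ι m` is the counting statement in `ε`–`δ` form for weight systems equal to `1`
  outside at most `m` indices; `CFZ.countingInd_zero` is the dense case and
  `CFZ.countingInd_succ` the densification step, following (6.2)–(6.9) of the proof of Thm. 6.2
  line by line with explicit constants (Cauchy–Schwarz (6.3), deletion of `ν_{-a}` by `CFZ.slf`,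
  `𝔼[(ν'-1)²] = O(δ)` (6.4), the cap `g'_{∧1} = min(g', 1)` with `0 ≤ g' - g'_{∧1} ≤ |ν' - 1|`
  (6.7), `‖g'_{∧1} - g̃'‖_□ = o(1)` (6.8) and the three terms of (6.9) by the induction
  hypothesis for the system with `ν_{-a}` replaced by `1`, `CFZ.CountingBd.replace`).
* `CFZ.relativeCounting_holds`: `k ≤ 1` directly, `k ≥ 2` by the induction run up to `m = k`.

All definitions in this file (`condExp`, `zs`, `thetaEquiv`, `dblSet`, `faceOf`, `faceProd`,
`slfFam`, `slfTop`, `slfFac`, `dens`, `CountingBd`, `CountingInd`) are proof-internal.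

## References
* D. Conlon, J. Fox, Y. Zhao, *The Green–Tao theorem: an exposition*, EMS Surv. Math. Sci. 1
  (2014), 249–282, §6: Prop. 6.1, Thm. 6.2 and its proof ((6.2)–(6.9)), Lemma 6.4, Thm. 6.5.
  [cite: ConlonFoxZhao2014]
* D. Conlon, J. Fox, Y. Zhao, *A relative Szemerédi theorem*, Geom. Funct. Anal. 25 (2015),
  733–762 (the full proof of Thm. 6.5 in print).
* B. Green, T. Tao, *Linear equations in primes*, Ann. of Math. 171 (2010), App. B, Cor. B.4
  (the weighted generalised von Neumann inequality, `Literature.NumberTheory.Sieve.weightedGvN`).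
-/

noncomputable section

open Finset
open scoped BigOperators


namespace Literature.Combinatorics.Additive.CFZ

/-! ## Towards Theorem 6.5: conditional expectations, rounding of decorations, dense counting -/

section Rounding

variable {ι : Type*} [Fintype ι] [DecidableEq ι] {X : Type*} [Fintype X] [Nonempty X]

/-- Conditional expectation onto the coordinates in `S`: `c̄(x) = 𝔼_y c(x on S, y off S)`.
[folklore] -/
def condExp (S : Finset ι) (c : (ι → X) → ℝ) (x : ι → X) : ℝ :=
  𝔼 y : ι → X, c (S.piecewise x y)

omit [Nonempty X] in
/-- `c̄` depends only on the coordinates in `S`. [folklore] -/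
theorem dependsOn_condExp (S : Finset ι) (c : (ι → X) → ℝ) :
    DependsOn (condExp S c) (↑S : Set ι) := by
  intro x x' hxx'
  unfold condExp
  refine Finset.expect_congr rfl fun y _ => ?_
  congr 1
  funext i
  by_cases hi : i ∈ S
  · rw [Finset.piecewise_eq_of_mem _ _ _ hi, Finset.piecewise_eq_of_mem _ _ _ hi, hxx' i hi]
  · rw [Finset.piecewise_eq_of_notMem _ _ _ hi, Finset.piecewise_eq_of_notMem _ _ _ hi]

omit [Fintype ι] [Fintype X] [Nonempty X] in
/-- `S.piecewise x y` is the mixed point reading `S` off `x` and the rest off `y`. [folklore] -/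
theorem piecewise_eq_mixPt (S : Finset ι) (x y : ι → X) : S.piecewise x y = Literature.NumberTheory.Sieve.mixPt y x S := by
  funext i
  by_cases hi : i ∈ S
  · rw [Finset.piecewise_eq_of_mem _ _ _ hi, Literature.NumberTheory.Sieve.mixPt_of_mem hi]
  · rw [Finset.piecewise_eq_of_notMem _ _ _ hi, Literature.NumberTheory.Sieve.mixPt_of_not_mem hi]

/-- The defining property of the conditional expectation: `𝔼 c̄ w = 𝔼 c w` for `w` depending
only on `S`. [folklore] -/
theorem expect_condExp_mul (S : Finset ι) (c w : (ι → X) → ℝ) (hw : DependsOn w (↑S : Set ι)) :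
    (𝔼 x, condExp S c x * w x) = 𝔼 x, c x * w x := by
  unfold condExp
  calc (𝔼 x : ι → X, (𝔼 y : ι → X, c (S.piecewise x y)) * w x)
      = 𝔼 x : ι → X, 𝔼 y : ι → X, c (S.piecewise x y) * w (S.piecewise x y) := by
        refine Finset.expect_congr rfl fun x _ => ?_
        rw [Finset.expect_mul]
        refine Finset.expect_congr rfl fun y _ => ?_
        rw [hw (fun i hi => (Finset.piecewise_eq_of_mem _ _ _ hi).symm)]
    _ = 𝔼 y : ι → X, 𝔼 x : ι → X, c (S.piecewise x y) * w (S.piecewise x y) :=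
        Finset.expect_comm _ _ _
    _ = 𝔼 p : (ι → X) × (ι → X), c (Literature.NumberTheory.Sieve.mixPt p.1 p.2 S) * w (Literature.NumberTheory.Sieve.mixPt p.1 p.2 S) := by
        rw [Literature.NumberTheory.Sieve.expect_expect_eq_expect_prod]
        simp_rw [piecewise_eq_mixPt]
    _ = 𝔼 x, c x * w x := Literature.NumberTheory.Sieve.expect_mixPt_self S (fun z => c z * w z)

/-- **Rounding a `[0,1]`-valued decoration to an indicator** ("since the expectation is
bilinear …, the extrema occur when `a` and `b` are `{0,1}`-valued", proof of Prop. 6.1): for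
`w : X^ι → [0,1]` depending on `S` there is a `{0,1}`-valued `b` depending on `S` with
`|𝔼 c w| ≤ |𝔼 c b|`. [cite: ConlonFoxZhao2014, proof of Proposition 6.1] -/
theorem exists_indicator_round (S : Finset ι) (c w : (ι → X) → ℝ) (hw : DependsOn w (↑S : Set ι))
    (hw01 : ∀ x, 0 ≤ w x ∧ w x ≤ 1) :
    ∃ b : (ι → X) → ℝ, (∀ x, b x = 0 ∨ b x = 1) ∧ DependsOn b (↑S : Set ι) ∧
      |𝔼 x, c x * w x| ≤ |𝔼 x, c x * b x| := by
  have hdep := dependsOn_condExp S c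
  rcases le_or_gt 0 (𝔼 x, c x * w x) with hpos | hneg
  · -- round up on `{c̄ > 0}`
    refine ⟨fun x => if 0 < condExp S c x then 1 else 0, fun x => by
        by_cases h : 0 < condExp S c x <;> simp [h], fun x x' h => by
        simp only [hdep h], ?_⟩
    rw [abs_of_nonneg hpos, ← expect_condExp_mul S c w hw,
      ← expect_condExp_mul S c _ (fun x x' h => by simp only [hdep h])]
    refine (Finset.expect_le_expect fun x _ => ?_).trans (le_abs_self _)
    by_cases h : 0 < condExp S c x
    · rw [if_pos h, mul_one]
      exact mul_le_of_le_one_right h.le (hw01 x).2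
    · rw [if_neg h, mul_zero]
      exact mul_nonpos_of_nonpos_of_nonneg (not_lt.mp h) (hw01 x).1
  · -- round down on `{c̄ < 0}`
    refine ⟨fun x => if condExp S c x < 0 then 1 else 0, fun x => by
        by_cases h : condExp S c x < 0 <;> simp [h], fun x x' h => by
        simp only [hdep h], ?_⟩
    rw [abs_of_neg hneg, ← expect_condExp_mul S c w hw,
      ← expect_condExp_mul S c _ (fun x x' h => by simp only [hdep h])]
    refine le_trans ?_ (neg_le_abs _)
    rw [neg_le_neg_iff]
    refine Finset.expect_le_expect fun x _ => ?_
    by_cases h : condExp S c x < 0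
    · rw [if_pos h, mul_one]
      exact le_mul_of_le_one_right h.le (hw01 x).2
    · rw [if_neg h, mul_zero]
      exact mul_nonneg (not_lt.mp h) (hw01 x).1

/-- **Cut norm bounds with `[0,1]`-valued decorations** (the form (6.1) of the cut norm used in
the proofs of Prop. 6.1 and Thm. 6.2: "`|𝔼[(g - g̃)(x,y) a(x) b(y)]| ≤ ε` for every function
`a : X → [0,1]` and `b : Y → [0,1]`"): if `‖F‖_{□(e)} ≤ δ` then `|𝔼 F ∏_{l ∈ e} w_l| ≤ δ` for
`[0,1]`-valued `w_l` depending on `e ∖ {l}`.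
[cite: ConlonFoxZhao2014, proof of Proposition 6.1, (6.1)] -/
theorem abs_expect_mul_prod_le {e : Finset ι} {F : (ι → X) → ℝ} {δ : ℝ} (hF : HasSmallCut e F δ)
    (w : ι → (ι → X) → ℝ) (hw01 : ∀ l x, 0 ≤ w l x ∧ w l x ≤ 1)
    (hwdep : ∀ l ∈ e, DependsOn (w l) (↑(e.erase l) : Set ι)) :
    |𝔼 x, F x * ∏ l ∈ e, w l x| ≤ δ := by
  -- induction on the set `t` of coordinates whose decoration is not yet `{0,1}`-valued
  suffices key : ∀ t : Finset ι, t ⊆ e → ∀ w : ι → (ι → X) → ℝ,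
      (∀ l x, 0 ≤ w l x ∧ w l x ≤ 1) → (∀ l ∈ e, DependsOn (w l) (↑(e.erase l) : Set ι)) →
      (∀ l ∈ e, l ∉ t → ∀ x, w l x = 0 ∨ w l x = 1) → |𝔼 x, F x * ∏ l ∈ e, w l x| ≤ δ from
    key e Finset.Subset.rfl w hw01 hwdep fun l hl hl' => absurd hl hl'
  intro t
  induction t using Finset.induction_on with
  | empty =>
    intro _ w hw01 hwdep h01
    -- `w` is a cut family on `e` (after replacing it by `1` off `e`)
    have hcut : IsCutFamily e (fun l x => if l ∈ e then w l x else 1) :=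
      ⟨fun l x => by
        by_cases hl : l ∈ e
        · simpa [hl] using h01 l hl (Finset.notMem_empty l) x
        · simp [hl], fun l hl x y hxy => by simpa [hl] using hwdep l hl hxy⟩
    have := hF _ hcut
    unfold cutAverage at this
    convert this using 4 with x
    exact Finset.prod_congr rfl fun l hl => by simp only [if_pos hl]
  | insert l₀ t hl₀ ih =>
    intro hte w hw01 hwdep h01
    have hl₀e : l₀ ∈ e := hte (Finset.mem_insert_self l₀ t)
    -- round the decoration `w l₀`
    set c : (ι → X) → ℝ := fun x => F x * ∏ l ∈ e.erase l₀, w l x with hc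
    obtain ⟨b, hb01, hbdep, hb⟩ :=
      exists_indicator_round (e.erase l₀) c (w l₀) (hwdep l₀ hl₀e) (hw01 l₀)
    have hsplit : ∀ w' : ι → (ι → X) → ℝ, (∀ l, l ≠ l₀ → w' l = w l) →
        (𝔼 x, F x * ∏ l ∈ e, w' l x) = 𝔼 x, c x * w' l₀ x := by
      intro w' hw'
      refine Finset.expect_congr rfl fun x _ => ?_
      rw [hc, ← Finset.mul_prod_erase e _ hl₀e]
      simp only
      rw [Finset.prod_congr rfl fun l hl => by rw [hw' l (Finset.ne_of_mem_erase hl)]]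
      ring
    rw [hsplit w fun l _ => rfl]
    refine hb.trans ?_
    have hw'eq : (𝔼 x, F x * ∏ l ∈ e, Function.update w l₀ b l x) = 𝔼 x, c x * b x := by
      rw [hsplit (Function.update w l₀ b) fun l hl => Function.update_of_ne hl _ _]
      simp only [Function.update_self]
    rw [← hw'eq]
    refine ih (fun l hl => hte (Finset.mem_insert_of_mem hl)) (Function.update w l₀ b) ?_ ?_ ?_
    · intro l x
      by_cases hl : l = l₀
      · subst hl; rw [Function.update_self]
        rcases hb01 x with h | h <;> simp [h]
      · rw [Function.update_of_ne hl]; exact hw01 l x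
    · intro l hl
      by_cases hll : l = l₀
      · subst hll; rw [Function.update_self]; exact hbdep
      · rw [Function.update_of_ne hll]; exact hwdep l hl
    · intro l hl hlt x
      by_cases hll : l = l₀
      · subst hll; rw [Function.update_self]; exact hb01 x
      · rw [Function.update_of_ne hll]
        exact h01 l hl (fun h => (Finset.mem_insert.mp h).elim hll hlt) x

/-- Decorations depending on all other coordinates: if `F` does not depend on the coordinate `a`,
`‖F‖_{□([k]∖{a})} ≤ δ`, and `u_j : X^k → [0,1]` depends on `{j}ᶜ` (it MAY depend on `a`), then
`|𝔼 F ∏_{j ≠ a} u_j| ≤ δ` (condition on `x_a`). This is how the cut norm hypothesis enters the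
proofs of Prop. 6.1 and Thm. 6.2 ("the expectation has the form (6.1) if we fix any value of
`z`"). [cite: ConlonFoxZhao2014, proof of Proposition 6.1] -/
theorem abs_expect_mul_prod_erase_le {a : ι} {F : (ι → X) → ℝ} {δ : ℝ}
    (hFdep : DependsOn F ({a}ᶜ : Set ι)) (hF : HasSmallCut (univ.erase a) F δ)
    (u : ι → (ι → X) → ℝ) (hu01 : ∀ j x, 0 ≤ u j x ∧ u j x ≤ 1)
    (hudep : ∀ j, DependsOn (u j) ({j}ᶜ : Set ι)) :
    |𝔼 x, F x * ∏ j ∈ univ.erase a, u j x| ≤ δ := by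
  -- re-randomise the coordinate `a`
  rw [← Literature.NumberTheory.Sieve.expect_expect_update a (fun x => F x * ∏ j ∈ univ.erase a, u j x),
    Finset.expect_comm]
  refine (Finset.abs_expect_le _ _).trans
    ((Finset.expect_le_expect fun c _ => ?_).trans
      (Finset.expect_const Finset.univ_nonempty δ).le)
  have hFa : ∀ x : ι → X, F (Function.update x a c) = F x := fun x =>
    hFdep fun i hi => Function.update_of_ne (by simpa using hi) _ _
  simp_rw [hFa]
  refine abs_expect_mul_prod_le hF (fun j x => u j (Function.update x a c))
    (fun j x => hu01 j _) fun j _ x y hxy => hudep j fun i hi => ?_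
  by_cases hia : i = a
  · subst hia; simp
  · rw [Function.update_of_ne hia, Function.update_of_ne hia]
    refine hxy i ?_
    have hij : i ≠ j := by simpa using hi
    simp [hij, hia]

/-- **Dense counting (Prop. 6.1 for simplices), telescoping form**: with all weights bounded by
`1`, replacing the `g_j`, `j ∈ s`, by `g̃_j` one at a time costs at most `‖g_j - g̃_j‖_□ ≤ δ`
each. [cite: ConlonFoxZhao2014, Proposition 6.1] -/
theorem dense_counting_aux {g g' : ι → (ι → X) → ℝ} {δ : ℝ}
    (hgdep : ∀ j, DependsOn (g j) ({j}ᶜ : Set ι)) (hg'dep : ∀ j, DependsOn (g' j) ({j}ᶜ : Set ι))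
    (hg01 : ∀ j x, 0 ≤ g j x ∧ g j x ≤ 1) (hg'01 : ∀ j x, 0 ≤ g' j x ∧ g' j x ≤ 1)
    (hcut : ∀ j, HasSmallCut (univ.erase j) (fun x => g j x - g' j x) δ) (s : Finset ι) :
    |(𝔼 x, (∏ j ∈ s, g j x) * ∏ j ∈ univ \ s, g' j x) - 𝔼 x, ∏ j, g' j x| ≤ s.card * δ := by
  induction s using Finset.induction_on with
  | empty => simp
  | insert a s ha ih =>
    have hstep : |(𝔼 x, (∏ j ∈ insert a s, g j x) * ∏ j ∈ univ \ insert a s, g' j x) -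
        𝔼 x, (∏ j ∈ s, g j x) * ∏ j ∈ univ \ s, g' j x| ≤ δ := by
      -- the difference is `𝔼 (g_a - g'_a) ∏_{j ≠ a} u_j`
      set u : ι → (ι → X) → ℝ := fun j => if j ∈ s then g j else g' j with hu
      have hsd : univ \ s = insert a (univ \ insert a s) := by
        ext j
        simp only [Finset.mem_sdiff, Finset.mem_univ, true_and, Finset.mem_insert, not_or]
        constructor
        · intro h
          by_cases hja : j = a
          · exact Or.inl hja
          · exact Or.inr ⟨hja, h⟩
        · rintro (rfl | ⟨_, h⟩)
          · exact ha
          · exact h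
      have ha' : a ∉ univ \ insert a s := by simp
      have hprod : ∀ x, (∏ j ∈ s, g j x) * ∏ j ∈ univ \ insert a s, g' j x =
          ∏ j ∈ univ.erase a, u j x := by
        intro x
        have : univ.erase a = s ∪ (univ \ insert a s) := by
          ext j
          simp only [Finset.mem_erase, Finset.mem_univ, and_true, Finset.mem_union,
            Finset.mem_sdiff, Finset.mem_insert, true_and, not_or]
          constructor
          · intro hja
            by_cases hjs : j ∈ s
            · exact Or.inl hjs
            · exact Or.inr ⟨hja, hjs⟩
          · rintro (hjs | ⟨hja, _⟩)
            · exact fun h => ha (h ▸ hjs)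
            · exact hja
        rw [this, Finset.prod_union (Finset.disjoint_left.mpr fun j hjs hj => by
          simp only [Finset.mem_sdiff, Finset.mem_insert, not_or] at hj; exact hj.2.2 hjs)]
        congr 1
        · exact Finset.prod_congr rfl fun j hj => by simp [hu, hj]
        · refine Finset.prod_congr rfl fun j hj => ?_
          simp only [Finset.mem_sdiff, Finset.mem_insert, not_or] at hj
          simp [hu, hj.2.2]
      have hdiff : (𝔼 x, (∏ j ∈ insert a s, g j x) * ∏ j ∈ univ \ insert a s, g' j x) -
          𝔼 x, (∏ j ∈ s, g j x) * ∏ j ∈ univ \ s, g' j x =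
          𝔼 x, (g a x - g' a x) * ∏ j ∈ univ.erase a, u j x := by
        rw [← Finset.expect_sub_distrib]
        refine Finset.expect_congr rfl fun x _ => ?_
        rw [Finset.prod_insert ha, hsd, Finset.prod_insert ha', ← hprod]
        ring
      rw [hdiff]
      refine abs_expect_mul_prod_erase_le (fun x y hxy => ?_) (hcut a) u (fun j x => ?_) ?_
      · rw [hgdep a hxy, hg'dep a hxy]
      · by_cases hj : j ∈ s
        · simp only [hu, hj, if_true]; exact hg01 j x
        · simp only [hu, hj, if_false]; exact hg'01 j x
      · intro j
        by_cases hj : j ∈ s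
        · simp only [hu, hj, if_true]; exact hgdep j
        · simp only [hu, hj, if_false]; exact hg'dep j
    calc |(𝔼 x, (∏ j ∈ insert a s, g j x) * ∏ j ∈ univ \ insert a s, g' j x) - 𝔼 x, ∏ j, g' j x|
        ≤ |(𝔼 x, (∏ j ∈ insert a s, g j x) * ∏ j ∈ univ \ insert a s, g' j x) -
            𝔼 x, (∏ j ∈ s, g j x) * ∏ j ∈ univ \ s, g' j x| +
          |(𝔼 x, (∏ j ∈ s, g j x) * ∏ j ∈ univ \ s, g' j x) - 𝔼 x, ∏ j, g' j x| :=
          abs_sub_le _ _ _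
      _ ≤ δ + s.card * δ := add_le_add hstep ih
      _ = (insert a s).card * δ := by rw [Finset.card_insert_of_notMem ha]; push_cast; ring

/-- **Dense simplex counting lemma** (Prop. 6.1 for `(k-1)`-uniform hypergraphs, "the proof of
Proposition 6.1 easily extends"): for `[0,1]`-valued `g, g̃` with `‖g_j - g̃_j‖_□ ≤ δ` for all
`j`, `|𝔼 ∏_j g_j - 𝔼 ∏_j g̃_j| ≤ k δ`. [cite: ConlonFoxZhao2014, Proposition 6.1 and Section 6] -/
theorem dense_counting {g g' : ι → (ι → X) → ℝ} {δ : ℝ}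
    (hgdep : ∀ j, DependsOn (g j) ({j}ᶜ : Set ι)) (hg'dep : ∀ j, DependsOn (g' j) ({j}ᶜ : Set ι))
    (hg01 : ∀ j x, 0 ≤ g j x ∧ g j x ≤ 1) (hg'01 : ∀ j x, 0 ≤ g' j x ∧ g' j x ≤ 1)
    (hcut : ∀ j, HasSmallCut (univ.erase j) (fun x => g j x - g' j x) δ) :
    |𝔼 x, (∏ j, g j x - ∏ j, g' j x)| ≤ Fintype.card ι * δ := by
  have := dense_counting_aux hgdep hg'dep hg01 hg'01 hcut univ
  simpa [Finset.expect_sub_distrib] using this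

end Rounding

end Literature.Combinatorics.Additive.CFZ

namespace Literature.Combinatorics.Additive.CFZ

/-! ## Towards Theorem 6.5: the strong linear forms estimate (Lemma 6.4 for simplices) -/

section Expansion

variable {Ω : Type*} [Fintype Ω] {κ : Type*} [DecidableEq κ]

/-- Alternating expansion with a weight: `𝔼 (∏_{ω ∈ P} (G_ω - 1)) W =
∑_{S ⊆ P} (-1)^{|P ∖ S|} 𝔼 (∏_{ω ∈ S} G_ω) W`. [folklore] -/
theorem expect_prod_sub_one_mul_eq (P : Finset κ) (G : κ → Ω → ℝ) (W : Ω → ℝ) :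
    (𝔼 q, (∏ ω ∈ P, (G ω q - 1)) * W q) =
      ∑ S ∈ P.powerset, (-1 : ℝ) ^ (P \ S).card * 𝔼 q, (∏ ω ∈ S, G ω q) * W q := by
  simp_rw [sub_eq_add_neg, Finset.prod_add, Finset.prod_const, Finset.sum_mul, Finset.expect_sum_comm,
    Finset.mul_expect]
  refine Finset.sum_congr rfl fun S _ => Finset.expect_congr rfl fun q _ => ?_
  ring

/-- If every weighted sub-product average is within `δ` of `1`, the alternating expansion is at
most `2^{|P|} δ` in absolute value (`P ≠ ∅`: the signs cancel the `1`'s). This is the mechanism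
"expand everything and observe that all the terms are `1 + o(1)` and the signs make all the `1`'s
cancel" of the proofs of Lemmas 6.3 and 6.4. [cite: ConlonFoxZhao2014, proofs of Lemmas 6.3 and 6.4] -/
theorem abs_expect_prod_sub_one_mul_le [Nonempty Ω] {P : Finset κ} (hP : P.Nonempty)
    (G : κ → Ω → ℝ) (W : Ω → ℝ) {δ : ℝ}
    (hδ : ∀ S, S ⊆ P → |(𝔼 q, (∏ ω ∈ S, G ω q) * W q) - 1| ≤ δ) :
    |𝔼 q, (∏ ω ∈ P, (G ω q - 1)) * W q| ≤ 2 ^ P.card * δ := by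
  have hzero : ∑ S ∈ P.powerset, (-1 : ℝ) ^ (P \ S).card = 0 := by
    have h := Finset.prod_add (fun _ => (1 : ℝ)) (fun _ => (-1 : ℝ)) P
    simp only [add_neg_cancel, Finset.prod_const_one, one_mul, Finset.prod_const] at h
    rw [← h]
    exact zero_pow (Finset.card_ne_zero.mpr hP)
  rw [expect_prod_sub_one_mul_eq]
  have : ∑ S ∈ P.powerset, (-1 : ℝ) ^ (P \ S).card * (𝔼 q, (∏ ω ∈ S, G ω q) * W q) =
      ∑ S ∈ P.powerset, (-1 : ℝ) ^ (P \ S).card * ((𝔼 q, (∏ ω ∈ S, G ω q) * W q) - 1) := by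
    simp_rw [mul_sub, Finset.sum_sub_distrib, mul_one, hzero, sub_zero]
  rw [this]
  refine (Finset.abs_sum_le_sum_abs _ _).trans ?_
  have hb : ∀ S ∈ P.powerset,
      |(-1 : ℝ) ^ (P \ S).card * ((𝔼 q, (∏ ω ∈ S, G ω q) * W q) - 1)| ≤ δ := by
    intro S hS
    rw [abs_mul, abs_pow, abs_neg, abs_one, one_pow, one_mul]
    exact hδ S (Finset.mem_powerset.mp hS)
  refine (Finset.sum_le_sum hb).trans ?_
  rw [Finset.sum_const, Finset.card_powerset, nsmul_eq_mul]
  push_cast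
  rfl

end Expansion

section OptionEmbedding

variable {ι : Type*} [DecidableEq ι] {X : Type*}

/-- Restriction of a point of `X^{Option ι}` to the coordinates `some i`. [folklore] -/
def zs (z : Option ι → X) : ι → X := fun i => z (some i)

omit [DecidableEq ι] in
/-- Coordinates of the restricted point. [folklore] -/
@[simp] theorem zs_apply (z : Option ι → X) (i : ι) : zs z i = z (some i) := rfl

/-- The change of variables of the strong linear forms estimate: a pair of points of
`X^{Option ι}` versus a pair of points of `X^ι` and two dummy coordinates; the extra coordinate
`none` of the first point becomes the `a`-coordinate of the second. [folklore] -/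
def thetaEquiv (a : ι) : ((Option ι → X) × (Option ι → X)) ≃ (((ι → X) × (ι → X)) × (X × X)) where
  toFun p := ((zs p.1, Function.update (zs p.2) a (p.1 none)), (p.2 none, p.2 (some a)))
  invFun q := (fun o => Option.casesOn o (q.1.2 a) (fun i => q.1.1 i),
    fun o => Option.casesOn o q.2.1 (fun i => if i = a then q.2.2 else q.1.2 i))
  left_inv p := by
    ext o
    · cases o with
      | none => simp
      | some i => rfl
    · cases o with
      | none => rfl
      | some i =>
        by_cases h : i = a
        · subst h; simp
        · simp [zs, h]
  right_inv q := by
    obtain ⟨⟨x₀, x₁⟩, d₁, d₂⟩ := q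
    ext i
    · rfl
    · by_cases h : i = a
      · subst h; simp
      · simp [zs, h]
    · rfl
    · simp

/-- Under `thetaEquiv`, mixed points over `ω.map some` restrict to mixed points over `ω`
(`a ∉ ω`). [folklore] -/
theorem zs_mixPt_thetaEquiv_symm (a : ι) (q : ((ι → X) × (ι → X)) × (X × X)) {ω : Finset ι}
    (hω : a ∉ ω) :
    zs (Literature.NumberTheory.Sieve.mixPt ((thetaEquiv a).symm q).1 ((thetaEquiv a).symm q).2
      (ω.map Function.Embedding.some)) = Literature.NumberTheory.Sieve.mixPt q.1.1 q.1.2 ω := by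
  funext i
  simp only [zs, Literature.NumberTheory.Sieve.mixPt, thetaEquiv, Equiv.coe_fn_symm_mk, Finset.mem_map,
    Function.Embedding.some_apply, Option.some.injEq, exists_eq_right]
  by_cases hi : i ∈ ω
  · have hia : i ≠ a := fun h => hω (h ▸ hi)
    simp [hi, hia]
  · simp [hi]

/-- Under `thetaEquiv`, the `none`-coordinate of a mixed point is the `a`-coordinate of the
second point. [folklore] -/
theorem mixPt_thetaEquiv_symm_none (a : ι) (q : ((ι → X) × (ι → X)) × (X × X))
    (ω : Finset ι) :
    Literature.NumberTheory.Sieve.mixPt ((thetaEquiv a).symm q).1 ((thetaEquiv a).symm q).2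
      (ω.map Function.Embedding.some) none = q.1.2 a := by
  simp [Literature.NumberTheory.Sieve.mixPt, thetaEquiv]

/-- Consequently `update (zs x^{(ω)}) a (x^{(ω)}_{none}) = x^{(ω ∪ {a})}` after the change of
variables. [folklore] -/
theorem update_zs_mixPt_thetaEquiv_symm (a : ι) (q : ((ι → X) × (ι → X)) × (X × X))
    {ω : Finset ι} (hω : a ∉ ω) :
    Function.update (zs (Literature.NumberTheory.Sieve.mixPt ((thetaEquiv a).symm q).1 ((thetaEquiv a).symm q).2
        (ω.map Function.Embedding.some))) a
      (Literature.NumberTheory.Sieve.mixPt ((thetaEquiv a).symm q).1 ((thetaEquiv a).symm q).2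
        (ω.map Function.Embedding.some) none) =
      Literature.NumberTheory.Sieve.mixPt q.1.1 q.1.2 (insert a ω) := by
  rw [zs_mixPt_thetaEquiv_symm a q hω, mixPt_thetaEquiv_symm_none, Literature.NumberTheory.Sieve.mixPt_insert]

end OptionEmbedding

end Literature.Combinatorics.Additive.CFZ

namespace Literature.Combinatorics.Additive.CFZ

section SLF

variable {ι : Type*} [Fintype ι] [DecidableEq ι] {X : Type*} [Fintype X] [Nonempty X]

/-- The doubled coordinates of the strong linear forms estimate: `{some j : j ≠ a}`.
[cite: ConlonFoxZhao2014, proof of Lemma 6.4] -/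
def dblSet (a : ι) : Finset (Option ι) := (univ.erase a).map Function.Embedding.some

/-- The face of the cube missing `some j`. [cite: ConlonFoxZhao2014, proof of Lemma 6.4] -/
def faceOf (a j : ι) : Finset (Option ι) := (dblSet a).erase (some j)

omit [Fintype X] [Nonempty X] in
/-- A face is the embedded image of `[k] ∖ {a, j}`. [folklore] -/
theorem faceOf_eq (a j : ι) :
    faceOf a j = ((univ.erase a).erase j).map Function.Embedding.some := by
  rw [faceOf, dblSet, Finset.map_erase, Finset.map_erase, Finset.map_erase]
  rfl

omit [Fintype X] [Nonempty X] in
/-- Membership in the doubled cube. [folklore] -/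
theorem mem_dblSet_iff (a : ι) (o : Option ι) : o ∈ dblSet a ↔ ∃ j, j ≠ a ∧ o = some j := by
  simp only [dblSet, Finset.mem_map, Finset.mem_erase, Finset.mem_univ, and_true,
    Function.Embedding.some_apply]
  exact ⟨fun ⟨j, hj, h⟩ => ⟨j, hj, h.symm⟩, fun ⟨j, hj, h⟩ => ⟨j, hj, h.symm⟩⟩

omit [Fintype X] [Nonempty X] in
/-- The doubled cube has `k - 1` coordinates. [folklore] -/
theorem card_dblSet (a : ι) : (dblSet a).card = Fintype.card ι - 1 := by
  rw [dblSet, Finset.card_map, Finset.card_erase_of_mem (Finset.mem_univ a), Finset.card_univ]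

omit [Fintype X] [Nonempty X] in
/-- Faces are strict subsets of the cube. [folklore] -/
theorem faceOf_mem_ssubsets {a j : ι} (hj : j ≠ a) : faceOf a j ∈ (dblSet a).powerset.erase (dblSet a) := by
  have hmem : some j ∈ dblSet a := (mem_dblSet_iff a _).mpr ⟨j, hj, rfl⟩
  rw [Finset.mem_erase, Finset.mem_powerset, faceOf]
  exact ⟨fun h => Finset.notMem_erase (some j) (dblSet a) (h.symm ▸ hmem), Finset.erase_subset _ _⟩

omit [Fintype X] [Nonempty X] in
/-- A face has one coordinate less than the cube. [folklore] -/
theorem card_faceOf {a j : ι} (hj : j ≠ a) : (faceOf a j).card = (dblSet a).card - 1 := by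
  rw [faceOf, Finset.card_erase_of_mem ((mem_dblSet_iff a _).mpr ⟨j, hj, rfl⟩)]

omit [Fintype X] [Nonempty X] in
/-- Distinct indices have distinct faces. [folklore] -/
theorem faceOf_injective (a : ι) {j j' : ι} (hj : j ≠ a) (h : faceOf a j = faceOf a j') : j = j' := by
  have hmem : some j ∈ dblSet a := (mem_dblSet_iff a _).mpr ⟨j, hj, rfl⟩
  have : some j ∉ faceOf a j := Finset.notMem_erase _ _
  rw [h, faceOf, Finset.mem_erase, not_and_or, not_not] at this
  rcases this with h1 | h1
  · exact Option.some_injective _ h1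
  · exact absurd hmem h1

omit [Fintype X] [Nonempty X] in
/-- The fibre of `faceOf a` over a face is a singleton. [folklore] -/
theorem filter_faceOf_eq {a j : ι} (hj : j ≠ a) :
    (univ.erase a).filter (fun l => faceOf a l = faceOf a j) = {j} := by
  ext l
  simp only [Finset.mem_filter, Finset.mem_erase, Finset.mem_univ, and_true, Finset.mem_singleton]
  constructor
  · rintro ⟨hl, h⟩; exact faceOf_injective a hl h
  · rintro rfl; exact ⟨hj, rfl⟩

omit [Fintype X] [Nonempty X] in
/-- No `l` has face `C` when `C` is smaller than a face. [folklore] -/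
theorem filter_faceOf_eq_empty {a : ι} {C : Finset (Option ι)} (hC : C.card < (dblSet a).card - 1) :
    (univ.erase a).filter (fun l => faceOf a l = C) = ∅ := by
  ext l
  simp only [Finset.mem_filter, Finset.mem_erase, Finset.mem_univ, and_true, Finset.notMem_empty,
    iff_false, not_and]
  intro hl h
  rw [← h, card_faceOf hl] at hC
  exact lt_irrefl _ hC

/-- Products over the fibre of `faceOf a` above `B`: the face functions of the
Gowers–Cauchy–Schwarz family. [cite: ConlonFoxZhao2014, proof of Lemma 6.4] -/
def faceProd (a : ι) (F : ι → (Option ι → X) → ℝ) (B : Finset (Option ι)) (z : Option ι → X) : ℝ :=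
  ∏ j ∈ (univ.erase a).filter (fun l => faceOf a l = B), F j z

/-- The Gowers–Cauchy–Schwarz family of the strong linear forms estimate: `top` on the full cube
`dblSet a`, `F_j` on the face missing `some j`, `1` elsewhere. [cite: ConlonFoxZhao2014, proof of Lemma 6.4] -/
def slfFam (a : ι) (top : (Option ι → X) → ℝ) (F : ι → (Option ι → X) → ℝ)
    (B : Finset (Option ι)) (z : Option ι → X) : ℝ :=
  if B = dblSet a then top z else faceProd a F B z

omit [Fintype X] [Nonempty X] in
/-- The family on the top cube. [folklore] -/
theorem slfFam_top (a : ι) (top : (Option ι → X) → ℝ) (F : ι → (Option ι → X) → ℝ) :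
    slfFam a top F (dblSet a) = top := by
  funext z; simp [slfFam]

omit [Fintype X] [Nonempty X] in
/-- The family below the top cube. [folklore] -/
theorem slfFam_of_ne (a : ι) (top : (Option ι → X) → ℝ) (F : ι → (Option ι → X) → ℝ)
    {B : Finset (Option ι)} (hB : B ≠ dblSet a) : slfFam a top F B = faceProd a F B := by
  funext z; simp [slfFam, hB]

omit [Fintype X] [Nonempty X] in
/-- The product of the family over all faces. [folklore] -/
theorem prod_slfFam (a : ι) (top : (Option ι → X) → ℝ) (F : ι → (Option ι → X) → ℝ)
    (z : Option ι → X) :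
    ∏ B ∈ (dblSet a).powerset, slfFam a top F B z = top z * ∏ j ∈ univ.erase a, F j z := by
  rw [← Finset.mul_prod_erase _ _ (Finset.mem_powerset_self _), slfFam_top]
  congr 1
  rw [← Finset.prod_fiberwise_of_maps_to (s := univ.erase a) (t := (dblSet a).powerset.erase (dblSet a))
    (g := faceOf a) (fun l hl => faceOf_mem_ssubsets (Finset.ne_of_mem_erase hl))]
  refine Finset.prod_congr rfl fun B hB => ?_
  rw [slfFam_of_ne a top F (Finset.mem_erase.mp hB).1, faceProd]

omit [Fintype X] [Nonempty X] in
/-- A function of `z` not depending on the coordinate `some j` depends on `faceOf a j ∪ (dblSet a)ᶜ`.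
[folklore] -/
theorem dependsOn_face {a j : ι} {G : (Option ι → X) → ℝ}
    (hG : DependsOn G ({some j}ᶜ : Set (Option ι))) :
    DependsOn G ((↑(faceOf a j) : Set (Option ι)) ∪ (↑(dblSet a) : Set (Option ι))ᶜ) := by
  refine hG.mono fun o ho => ?_
  by_cases h : o ∈ dblSet a
  · left
    rw [Finset.mem_coe, faceOf, Finset.mem_erase]
    exact ⟨ho, h⟩
  · right; exact h

omit [Fintype X] [Nonempty X] in
/-- The dependence hypothesis of `Literature.NumberTheory.Sieve.weightedGvN` for the family `slfFam`. [folklore] -/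
theorem dependsOn_slfFam (a : ι) (top : (Option ι → X) → ℝ) (F : ι → (Option ι → X) → ℝ)
    (hF : ∀ j, DependsOn (F j) ({some j}ᶜ : Set (Option ι))) (B : Finset (Option ι))
    (hB : B ⊆ dblSet a) :
    DependsOn (slfFam a top F B) ((↑B : Set (Option ι)) ∪ (↑(dblSet a) : Set (Option ι))ᶜ) := by
  by_cases h : B = dblSet a
  · subst h
    rw [slfFam_top, Set.union_compl_self]
    exact dependsOn_univ _
  · rw [slfFam_of_ne a top F h]
    intro z z' hzz'
    unfold faceProd
    refine Finset.prod_congr rfl fun j hj => ?_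
    rw [Finset.mem_filter] at hj
    rw [← hj.2] at hzz'
    exact dependsOn_face (hF j) hzz'

omit [Nonempty X] in
/-- The simplex integrand on `X^{Option ι}`, `z ↦ (u, x)`, `u = z none`, `x = zs z`: averaging over
`z` is averaging over `x` and `u`. [folklore] -/
theorem expect_option_eq (G : X → (ι → X) → ℝ) :
    (𝔼 z : Option ι → X, G (z none) (zs z)) = 𝔼 x : ι → X, 𝔼 u : X, G u x := by
  rw [← Fintype.expect_equiv (Equiv.piOptionEquivProd (β := fun _ => X)).symm
    (fun q : X × (ι → X) => G q.1 q.2)]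
  · rw [Literature.NumberTheory.Sieve.expect_prod_eq, Finset.expect_comm]
  · intro q; rfl

end SLF

end Literature.Combinatorics.Additive.CFZ
namespace Literature.Combinatorics.Additive.CFZ

/-! ## Towards Theorem 6.5: sub-products of the linear forms condition, densification -/

section LFCGeneral

variable {ι : Type*} [Fintype ι] [DecidableEq ι] {X : Type*} [Fintype X] [Nonempty X]

omit [Nonempty X] in
/-- **Sub-products of the linear forms condition, reindexed.** If every factor of a finite product
is either `1` or one of the `k 2^{k-1}` factors `ν_{-j}(x^{(ω)}_{-j})` (`j ∉ ω`), distinct factors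
being distinct forms, then its average is within `δ` of `1` ("the same statement holds if any
subset of the factors are deleted / replaced"). [cite: ConlonFoxZhao2014, Section 6 (before Theorem 6.5)] -/
theorem LFCWithin.general {ν : ι → (ι → X) → ℝ} {δ : ℝ} (hν : LFCWithin ν δ) {κ : Type*}
    (E : Finset κ) (jf : κ → ι) (ωf : κ → Finset ι) (wt : κ → (ι → X) → ℝ)
    (hwt : ∀ p ∈ E, wt p = ν (jf p) ∨ wt p = fun _ => 1) (hvalid : ∀ p ∈ E, jf p ∉ ωf p)
    (hinj : Set.InjOn (fun p => (jf p, ωf p)) E) :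
    |(𝔼 q : (ι → X) × (ι → X), ∏ p ∈ E, wt p (Literature.NumberTheory.Sieve.mixPt q.1 q.2 (ωf p))) - 1| ≤ δ := by
  classical
  set E₁ := E.filter (fun p => wt p = ν (jf p)) with hE₁
  have hsplit : ∀ q : (ι → X) × (ι → X), ∏ p ∈ E, wt p (Literature.NumberTheory.Sieve.mixPt q.1 q.2 (ωf p)) =
      ∏ p' ∈ E₁.image (fun p => (jf p, ωf p)), ν p'.1 (Literature.NumberTheory.Sieve.mixPt q.1 q.2 p'.2) := by
    intro q
    rw [← Finset.prod_filter_mul_prod_filter_not E (fun p => wt p = ν (jf p))]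
    have h1 : ∏ p ∈ E.filter (fun p => ¬ wt p = ν (jf p)), wt p (Literature.NumberTheory.Sieve.mixPt q.1 q.2 (ωf p)) = 1 := by
      refine Finset.prod_eq_one fun p hp => ?_
      rw [Finset.mem_filter] at hp
      rcases hwt p hp.1 with h | h
      · exact absurd h hp.2
      · rw [h]
    rw [h1, mul_one, Finset.prod_image]
    · refine Finset.prod_congr rfl fun p hp => ?_
      rw [(Finset.mem_filter.mp hp).2]
    · exact fun p hp p' hp' h => hinj (Finset.mem_filter.mp hp).1 (Finset.mem_filter.mp hp').1 h
  simp_rw [hsplit]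
  refine hν _ fun p' hp' => ?_
  obtain ⟨p, hp, rfl⟩ := Finset.mem_image.mp hp'
  exact hvalid p (Finset.mem_filter.mp hp).1

/-- The average of a single weight is at most `1 + δ`. [cite: ConlonFoxZhao2014, Section 6] -/
theorem LFCWithin.expect_le {ν : ι → (ι → X) → ℝ} {δ : ℝ} (hν : LFCWithin ν δ) (a : ι) :
    𝔼 x : ι → X, ν a x ≤ 1 + δ := by
  have h := hν {(a, (∅ : Finset ι))} (by simp)
  simp only [Finset.prod_singleton, Literature.NumberTheory.Sieve.mixPt_empty] at h
  rw [Literature.NumberTheory.Sieve.expect_prod_fst] at h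
  linarith [(abs_le.mp h).2]

omit [Nonempty X] in
/-- Replacing one weight by `1` preserves the linear forms condition.
[cite: ConlonFoxZhao2014, proof of Theorem 6.2] -/
theorem LFCWithin.update_one {ν : ι → (ι → X) → ℝ} {δ : ℝ} (hν : LFCWithin ν δ) (a : ι) :
    LFCWithin (Function.update ν a fun _ => 1) δ := by
  intro E hE
  refine hν.general E Prod.fst Prod.snd (fun p => Function.update ν a (fun _ => 1) p.1)
    (fun p _ => ?_) hE fun p _ p' _ h => by simpa [Prod.ext_iff] using h
  by_cases h : p.1 = a
  · right; rw [h, Function.update_self]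
  · left; rw [Function.update_of_ne h]

end LFCGeneral

section Densify

variable {ι : Type*} [Fintype ι] [DecidableEq ι] {X : Type*} [Fintype X] [Nonempty X]

/-- **Densification** (proof of Thm. 6.2 / Thm. 6.5): `G'(x_{-a}) = 𝔼_{x_a} ∏_{j ≠ a} G_j(x_{-j})`,
the codegree-type weight obtained by averaging out the coordinate `a`; used with `G = ν, g, g̃`
(`ν', g', g̃'` of the source). [cite: ConlonFoxZhao2014, proof of Theorem 6.5] -/
def dens (a : ι) (G : ι → (ι → X) → ℝ) (x : ι → X) : ℝ :=
  𝔼 u : X, ∏ j ∈ univ.erase a, G j (Function.update x a u)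

omit [Nonempty X] in
/-- `G'` ignores the averaged coordinate. [folklore] -/
theorem dens_update (a : ι) (G : ι → (ι → X) → ℝ) (x : ι → X) (v : X) :
    dens a G (Function.update x a v) = dens a G x := by
  simp [dens]

omit [Nonempty X] in
/-- `G'` is a function on `X_{-a}`. [cite: ConlonFoxZhao2014, proof of Theorem 6.5] -/
theorem dependsOn_dens (a : ι) (G : ι → (ι → X) → ℝ) : DependsOn (dens a G) ({a}ᶜ : Set ι) := by
  intro x y hxy
  unfold dens
  refine Finset.expect_congr rfl fun u _ => ?_
  have hu : Function.update x a u = Function.update y a u := by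
    funext i
    by_cases hi : i = a
    · subst hi; simp
    · rw [Function.update_of_ne hi, Function.update_of_ne hi]; exact hxy i (by simpa using hi)
  rw [hu]

omit [Nonempty X] in
/-- `G' ≥ 0` for `G ≥ 0`. [folklore] -/
theorem dens_nonneg {a : ι} {G : ι → (ι → X) → ℝ} (hG : ∀ j x, 0 ≤ G j x) (x : ι → X) :
    0 ≤ dens a G x :=
  Finset.expect_nonneg fun _ _ => Finset.prod_nonneg fun j _ => hG j _

omit [Nonempty X] in
/-- Densification is monotone on non-negative systems (`0 ≤ g ≤ ν ⟹ g' ≤ ν'`).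
[cite: ConlonFoxZhao2014, proof of Theorem 6.2, (6.7)] -/
theorem dens_mono {a : ι} {G H : ι → (ι → X) → ℝ} (hG : ∀ j x, 0 ≤ G j x)
    (hGH : ∀ j x, G j x ≤ H j x) (x : ι → X) : dens a G x ≤ dens a H x :=
  Finset.expect_le_expect fun _ _ => Finset.prod_le_prod (fun j _ => hG j _) fun j _ => hGH j _

/-- `0 ≤ g̃ ≤ 1 ⟹ g̃' ≤ 1`. [cite: ConlonFoxZhao2014, proof of Theorem 6.2] -/
theorem dens_le_one {a : ι} {G : ι → (ι → X) → ℝ} (hG : ∀ j x, 0 ≤ G j x)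
    (hG1 : ∀ j x, G j x ≤ 1) (x : ι → X) : dens a G x ≤ 1 := by
  refine (Finset.expect_le_expect fun u _ => Finset.prod_le_one (fun j _ => hG j _)
    fun j _ => hG1 j _).trans ?_
  rw [Finset.expect_const Finset.univ_nonempty]

/-- **Un-re-randomisation of one coordinate**: if `F` does not depend on `x_a`, then
`𝔼_x F(x) H(x) = 𝔼_x F(x) 𝔼_u H(x|_{a := u})`. [folklore] -/
theorem expect_mul_eq_expect_mul_expect_update (a : ι) {F : (ι → X) → ℝ}
    (hF : DependsOn F ({a}ᶜ : Set ι)) (H : (ι → X) → ℝ) :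
    (𝔼 x, F x * H x) = 𝔼 x, F x * 𝔼 u : X, H (Function.update x a u) := by
  have hFa : ∀ (x : ι → X) (u : X), F (Function.update x a u) = F x := fun _ _ =>
    hF fun i hi => Function.update_of_ne (by simpa using hi) _ _
  calc (𝔼 x, F x * H x)
      = 𝔼 x, 𝔼 u : X, F (Function.update x a u) * H (Function.update x a u) :=
        (Literature.NumberTheory.Sieve.expect_expect_update a (fun x => F x * H x)).symm
    _ = 𝔼 x, F x * 𝔼 u : X, H (Function.update x a u) := by
        refine Finset.expect_congr rfl fun x _ => ?_
        simp_rw [hFa, Finset.mul_expect]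

/-- In particular `𝔼_x F(x) ∏_{j ≠ a} G_j(x) = 𝔼_x F(x) G'(x)` for `F` on `X_{-a}` (how the
densified weights enter: `𝔼[g g g] = 𝔼[g g']`). [cite: ConlonFoxZhao2014, proof of Theorem 6.2, (6.2)] -/
theorem expect_mul_prod_erase_eq (a : ι) {F : (ι → X) → ℝ} (hF : DependsOn F ({a}ᶜ : Set ι))
    (G : ι → (ι → X) → ℝ) :
    (𝔼 x, F x * ∏ j ∈ univ.erase a, G j x) = 𝔼 x, F x * dens a G x :=
  expect_mul_eq_expect_mul_expect_update a hF _

/-- The simplex density through the densified weight: `𝔼 ∏_j G_j = 𝔼 G_a G'`.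
[cite: ConlonFoxZhao2014, proof of Theorem 6.2, (6.2)] -/
theorem expect_prod_eq_expect_mul_dens (a : ι) {G : ι → (ι → X) → ℝ}
    (hG : DependsOn (G a) ({a}ᶜ : Set ι)) :
    (𝔼 x, ∏ j, G j x) = 𝔼 x, G a x * dens a G x := by
  rw [← expect_mul_prod_erase_eq a hG]
  refine Finset.expect_congr rfl fun x _ => ?_
  exact (Finset.mul_prod_erase univ (fun j => G j x) (Finset.mem_univ a)).symm

/-- Averages of a function of one coordinate of a uniform point. [folklore] -/
theorem expect_apply_coord (a : ι) (f : X → ℝ) : (𝔼 x : ι → X, f (x a)) = 𝔼 u : X, f u := by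
  rw [← Literature.NumberTheory.Sieve.expect_expect_update a (fun x : ι → X => f (x a))]
  simp

/-- `𝔼 ν' = 1 + O(δ)`: `|𝔼_x ∏_{j ≠ a} ν_j(x) - 1| ≤ δ`. [cite: ConlonFoxZhao2014, proof of Theorem 6.2] -/
theorem abs_expect_dens_sub_one_le {ν : ι → (ι → X) → ℝ} {δ : ℝ} (hν : LFCWithin ν δ) (a : ι) :
    |(𝔼 x : ι → X, dens a ν x) - 1| ≤ δ := by
  have h1 : (𝔼 x : ι → X, dens a ν x) = 𝔼 x : ι → X, ∏ j ∈ univ.erase a, ν j x := by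
    have := expect_mul_prod_erase_eq a (F := fun _ => (1 : ℝ)) (fun _ _ _ => rfl) ν
    simpa using this.symm
  have h2 := hν.general (univ.erase a) id (fun _ => ∅) ν (fun p _ => Or.inl rfl) (by simp)
    (fun p _ p' _ h => by simpa using h)
  simp only [Literature.NumberTheory.Sieve.mixPt_empty] at h2
  have h3 : (𝔼 x : ι → X, dens a ν x) =
      𝔼 q : (ι → X) × (ι → X), ∏ j ∈ univ.erase a, ν (id j) q.1 := by
    rw [h1]
    exact (Literature.NumberTheory.Sieve.expect_prod_fst (Y' := ι → X) (fun x : ι → X => ∏ j ∈ univ.erase a, ν j x)).symm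
  rw [h3]
  exact h2

/-- `𝔼 ν'² = 1 + O(δ)`: `𝔼_x (ν'(x))² ≤ 1 + δ`. [cite: ConlonFoxZhao2014, proof of Theorem 6.2, (6.4)] -/
theorem expect_dens_sq_le {ν : ι → (ι → X) → ℝ} {δ : ℝ} (hν : LFCWithin ν δ) (a : ι) :
    (𝔼 x : ι → X, dens a ν x ^ 2) ≤ 1 + δ := by
  -- `𝔼 ν'² = 𝔼_{x, u} ∏_{j ≠ a} ν_j(x) ν_j(x|_{a := u})`
  have hins : ∀ q : (ι → X) × (ι → X),
      Literature.NumberTheory.Sieve.mixPt q.1 q.2 {a} = Function.update q.1 a (q.2 a) := by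
    intro q
    rw [← Finset.insert_empty, Literature.NumberTheory.Sieve.mixPt_insert, Literature.NumberTheory.Sieve.mixPt_empty]
  have h1 : (𝔼 x : ι → X, dens a ν x ^ 2) =
      𝔼 q : (ι → X) × (ι → X), (∏ j ∈ univ.erase a, ν j (Literature.NumberTheory.Sieve.mixPt q.1 q.2 ∅)) *
        ∏ j ∈ univ.erase a, ν j (Literature.NumberTheory.Sieve.mixPt q.1 q.2 {a}) := by
    simp only [Literature.NumberTheory.Sieve.mixPt_empty, hins]
    symm
    calc (𝔼 q : (ι → X) × (ι → X), (∏ j ∈ univ.erase a, ν j q.1) *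
          ∏ j ∈ univ.erase a, ν j (Function.update q.1 a (q.2 a)))
        = 𝔼 x : ι → X, 𝔼 x' : ι → X, (∏ j ∈ univ.erase a, ν j x) *
            ∏ j ∈ univ.erase a, ν j (Function.update x a (x' a)) := Literature.NumberTheory.Sieve.expect_prod_eq _
      _ = 𝔼 x : ι → X, (∏ j ∈ univ.erase a, ν j x) *
            𝔼 u : X, ∏ j ∈ univ.erase a, ν j (Function.update x a u) := by
          refine Finset.expect_congr rfl fun x _ => ?_
          rw [expect_apply_coord a (fun u => (∏ j ∈ univ.erase a, ν j x) *
            ∏ j ∈ univ.erase a, ν j (Function.update x a u)), Finset.mul_expect]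
      _ = 𝔼 x : ι → X, dens a ν x * ∏ j ∈ univ.erase a, ν j x := by
          refine Finset.expect_congr rfl fun x _ => ?_
          rw [mul_comm]
          rfl
      _ = 𝔼 x : ι → X, dens a ν x ^ 2 := by
          rw [expect_mul_prod_erase_eq a (dependsOn_dens a ν) ν]
          refine Finset.expect_congr rfl fun x _ => ?_
          rw [sq]
  have h2 := hν.general ((univ.erase a).disjSum (univ.erase a)) (Sum.elim id id)
    (Sum.elim (fun _ => ∅) (fun _ => {a})) (fun p => ν (Sum.elim id id p)) (fun p _ => Or.inl rfl)
    (by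
      rintro (j | j) hj
      · simp
      · simp only [Finset.inr_mem_disjSum, Finset.mem_erase] at hj
        simp [hj.1])
    (by
      rintro (j | j) hj (j' | j') hj' h
      · simpa using h
      · simp at h
      · simp at h
      · simpa using h)
  simp only [Finset.prod_disjSum, Sum.elim_inl, Sum.elim_inr, id] at h2
  rw [h1]
  linarith [(abs_le.mp h2).2]

end Densify

end Literature.Combinatorics.Additive.CFZ
namespace Literature.Combinatorics.Additive.CFZ

/-! ## The strong linear forms estimate (Lemma 6.4 for simplices) -/

section SLFMain

variable {ι : Type*} [Fintype ι] [DecidableEq ι] {X : Type*} [Fintype X] [Nonempty X]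

omit [Fintype ι] [DecidableEq ι] in
/-- Products over the power set of an embedded image. [folklore] -/
theorem prod_powerset_map {β : Type*} [DecidableEq β] (f : ι ↪ β) (s : Finset ι)
    (Φ : Finset β → ℝ) : ∏ ω ∈ (s.map f).powerset, Φ ω = ∏ ω ∈ s.powerset, Φ (ω.map f) := by
  classical
  rw [Finset.map_eq_image, Finset.powerset_image, Finset.prod_image]
  · exact Finset.prod_congr rfl fun ω _ => by rw [Finset.map_eq_image]
  · intro x _ y _ h
    apply Finset.map_injective f
    rwa [Finset.map_eq_image, Finset.map_eq_image]

omit [Fintype X] [Nonempty X] in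
/-- On a face the fibre product is the single face function. [folklore] -/
theorem faceProd_faceOf {a j : ι} (hj : j ≠ a) (F : ι → (Option ι → X) → ℝ) :
    faceProd a F (faceOf a j) = F j := by
  funext z
  rw [faceProd, filter_faceOf_eq hj, Finset.prod_singleton]

omit [Fintype X] [Nonempty X] in
/-- Below the faces the fibre product is `1`. [folklore] -/
theorem faceProd_of_card_lt {a : ι} {C : Finset (Option ι)} (hC : C.card < (dblSet a).card - 1)
    (F : ι → (Option ι → X) → ℝ) : faceProd a F C = fun _ => 1 := by
  funext z
  rw [faceProd, filter_faceOf_eq_empty hC, Finset.prod_empty]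

omit [Fintype X] [Nonempty X] in
/-- Strict subsets of strict subsets of the cube lie below the faces. [folklore] -/
theorem card_lt_of_mem_ssubsets_ssubsets {a : ι} {B C : Finset (Option ι)}
    (hB : B ∈ (dblSet a).ssubsets) (hC : C ∈ B.ssubsets) : C.card < (dblSet a).card - 1 := by
  have h1 := Finset.card_lt_card (Finset.mem_ssubsets.mp hB)
  have h2 := Finset.card_lt_card (Finset.mem_ssubsets.mp hC)
  omega

omit [Nonempty X] in
/-- **Sub-products of the linear forms condition in face form**: for `S ⊆ {0,1}^{[k]∖{a}}` and
`J ⊆ [k] ∖ {a}`, the average of `∏_{ω ∈ S} ν_{-a}(x^{(ω)}) ∏_{j ∈ J} ∏_{ω ∈ {0,1}^{[k]∖{a,j}}}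
μ_j(x^{(ω)}) μ'_j(x^{(ω ∪ a)})` is within `δ` of `1` whenever each `μ_j, μ'_j` is `ν_{-j}` or `1`
(the factors are distinct forms of the `k`-linear forms condition). This is the computation
"expand everything and observe that all the terms are `1 + o(1)`" of the proof of Lemma 6.4.
[cite: ConlonFoxZhao2014, proof of Lemma 6.4] -/
theorem lfc_face_product {ν μ μ' : ι → (ι → X) → ℝ} {δ : ℝ} (hν : LFCWithin ν δ) (a : ι)
    (hμ : ∀ j, μ j = ν j ∨ μ j = fun _ => 1) (hμ' : ∀ j, μ' j = ν j ∨ μ' j = fun _ => 1)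
    {S : Finset (Finset ι)} (hS : S ⊆ (univ.erase a).powerset) {J : Finset ι}
    (hJ : J ⊆ univ.erase a) :
    |(𝔼 q : (ι → X) × (ι → X), (∏ ω ∈ S, ν a (Literature.NumberTheory.Sieve.mixPt q.1 q.2 ω)) *
        ∏ j ∈ J, ∏ ω ∈ ((univ.erase a).erase j).powerset,
          (μ j (Literature.NumberTheory.Sieve.mixPt q.1 q.2 ω) * μ' j (Literature.NumberTheory.Sieve.mixPt q.1 q.2 (insert a ω)))) - 1| ≤ δ := by
  -- the index set of pairs `(j, ω)`, `j ∈ J`, `ω ⊆ [k] ∖ {a, j}`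
  set R : Finset (ι × Finset ι) :=
    univ.filter (fun p => p.1 ∈ J ∧ p.2 ⊆ (univ.erase a).erase p.1) with hR
  have hRmem : ∀ p : ι × Finset ι, p ∈ R ↔ p.1 ∈ J ∧ p.2 ∈ ((univ.erase a).erase p.1).powerset := by
    intro p
    simp [hR]
  have hR1 : ∀ p ∈ R, p.1 ≠ a ∧ p.1 ∉ p.2 ∧ a ∉ p.2 := by
    intro p hp
    rw [hRmem, Finset.mem_powerset] at hp
    refine ⟨(Finset.mem_erase.mp (hJ hp.1)).1, fun h => ?_, fun h => ?_⟩
    · have := hp.2 h; simp at this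
    · have := hp.2 h; simp at this
  have hS1 : ∀ ω ∈ S, a ∉ ω := fun ω hω h => by
    have := Finset.mem_powerset.mp (hS hω) h; simp at this
  have hprod : ∀ q : (ι → X) × (ι → X),
      (∏ ω ∈ S, ν a (Literature.NumberTheory.Sieve.mixPt q.1 q.2 ω)) *
        ∏ j ∈ J, ∏ ω ∈ ((univ.erase a).erase j).powerset,
          (μ j (Literature.NumberTheory.Sieve.mixPt q.1 q.2 ω) * μ' j (Literature.NumberTheory.Sieve.mixPt q.1 q.2 (insert a ω))) =
      ∏ p ∈ S.disjSum (R.disjSum R),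
        (Sum.elim (fun _ => ν a) (Sum.elim (fun p => μ p.1) (fun p => μ' p.1)) p)
          (Literature.NumberTheory.Sieve.mixPt q.1 q.2 (Sum.elim id (Sum.elim Prod.snd (fun p => insert a p.2)) p)) := by
    intro q
    rw [Finset.prod_disjSum, Finset.prod_disjSum]
    simp only [Sum.elim_inl, Sum.elim_inr, id]
    congr 1
    rw [← Finset.prod_mul_distrib]
    exact (Finset.prod_finset_product' R J (fun j => ((univ.erase a).erase j).powerset) hRmem
      (f := fun j ω => μ j (Literature.NumberTheory.Sieve.mixPt q.1 q.2 ω) * μ' j (Literature.NumberTheory.Sieve.mixPt q.1 q.2 (insert a ω)))).symm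
  simp_rw [hprod]
  refine hν.general _ (Sum.elim (fun _ => a) (Sum.elim Prod.fst Prod.fst)) _ _ ?_ ?_ ?_
  · rintro (ω | p | p) _
    · exact Or.inl rfl
    · exact hμ p.1
    · exact hμ' p.1
  · rintro (ω | p | p) hp
    · exact hS1 ω (by simpa using hp)
    · exact (hR1 p (by simpa using hp)).2.1
    · have h := hR1 p (by simpa using hp)
      simp only [Sum.elim_inr, Finset.mem_insert, not_or]
      exact ⟨h.1, h.2.1⟩
  · rintro (ω | p | p) hp (ω' | p' | p') hp' h <;>
      simp only [Sum.elim_inl, Sum.elim_inr, id, Prod.mk.injEq] at h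
    · rw [h.2]
    · exact absurd h.1.symm (hR1 p' (by simpa using hp')).1
    · exact absurd h.1.symm (hR1 p' (by simpa using hp')).1
    · exact absurd h.1 (hR1 p (by simpa using hp)).1
    · rw [Prod.ext h.1 h.2]
    · exact absurd (h.2 ▸ Finset.mem_insert_self a p'.2) (hR1 p (by simpa using hp)).2.2
    · exact absurd h.1 (hR1 p (by simpa using hp)).1
    · exact absurd (h.2 ▸ Finset.mem_insert_self a p.2) (hR1 p' (by simpa using hp')).2.2
    · have h2 : p.2 = p'.2 := by
        rw [← Finset.erase_insert (hR1 p (by simpa using hp)).2.2, h.2,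
          Finset.erase_insert (hR1 p' (by simpa using hp')).2.2]
      rw [Prod.ext h.1 h2]

/-- The top function of the Gowers–Cauchy–Schwarz family of the strong linear forms estimate:
`ν_{-a} - 1` read off the restricted point. [cite: ConlonFoxZhao2014, proof of Lemma 6.4] -/
def slfTop (a : ι) (ν : ι → (ι → X) → ℝ) (z : Option ι → X) : ℝ := ν a (zs z) - 1

/-- The face functions of the family: `h_j(x|_{a := u}) h'_j(x|_{a := u'})` with `x = zs z`,
`u = z (some a)`, `u' = z none`. [cite: ConlonFoxZhao2014, proof of Lemma 6.4] -/
def slfFac (a : ι) (h h' : ι → (ι → X) → ℝ) (j : ι) (z : Option ι → X) : ℝ :=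
  h j (zs z) * h' j (Function.update (zs z) a (z none))

omit [Fintype ι] [Fintype X] [Nonempty X] in
/-- `slfFac a h h' j` does not depend on the coordinate `some j`. [folklore] -/
theorem dependsOn_slfFac (a : ι) {h h' : ι → (ι → X) → ℝ}
    (hh : ∀ j, DependsOn (h j) ({j}ᶜ : Set ι)) (hh' : ∀ j, DependsOn (h' j) ({j}ᶜ : Set ι))
    (j : ι) : DependsOn (slfFac a h h' j) ({some j}ᶜ : Set (Option ι)) := by
  intro z z' hzz'
  have hn : z none = z' none := hzz' none (by simp)
  have hs : ∀ i, i ≠ j → z (some i) = z' (some i) := fun i hi => hzz' (some i) (by simpa using hi)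
  unfold slfFac
  congr 1
  · exact hh j fun i hi => hs i (by simpa using hi)
  · refine hh' j fun i hi => ?_
    have hij : i ≠ j := by simpa using hi
    by_cases hia : i = a
    · subst hia; simp [hn]
    · rw [Function.update_of_ne hia, Function.update_of_ne hia]; exact hs i hij

/-- **Step 1 of the strong linear forms estimate**: the expression
`𝔼_x (ν_{-a} - 1) h' h''` (with the densified `h' = 𝔼_u ∏ h_j`, `h'' = 𝔼_{u'} ∏ h'_j`) as the
average of the Gowers–Cauchy–Schwarz product over `X^{Option ι}`.
[cite: ConlonFoxZhao2014, proof of Lemma 6.4] -/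
theorem slf_expect_eq (a : ι) {ν h h' : ι → (ι → X) → ℝ}
    (hν : DependsOn (ν a) ({a}ᶜ : Set ι)) :
    (𝔼 x, (ν a x - 1) * (dens a h x * dens a h' x)) =
      𝔼 z : Option ι → X, slfTop a ν z * ∏ j ∈ univ.erase a, slfFac a h h' j z := by
  have hdep : DependsOn (fun x => (ν a x - 1) * dens a h' x) ({a}ᶜ : Set ι) := by
    intro x y hxy
    simp only [hν hxy, dependsOn_dens a h' hxy]
  calc (𝔼 x, (ν a x - 1) * (dens a h x * dens a h' x))
      = 𝔼 x, ((ν a x - 1) * dens a h' x) * dens a h x :=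
        Finset.expect_congr rfl fun x _ => by ring
    _ = 𝔼 x, ((ν a x - 1) * dens a h' x) * ∏ j ∈ univ.erase a, h j x :=
        (expect_mul_prod_erase_eq a hdep h).symm
    _ = 𝔼 x, 𝔼 u : X, ((ν a x - 1) * ∏ j ∈ univ.erase a, h' j (Function.update x a u)) *
          ∏ j ∈ univ.erase a, h j x := by
        refine Finset.expect_congr rfl fun x _ => ?_
        rw [dens, Finset.mul_expect, Finset.expect_mul]
    _ = 𝔼 z : Option ι → X, ((ν a (zs z) - 1) *
          ∏ j ∈ univ.erase a, h' j (Function.update (zs z) a (z none))) *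
            ∏ j ∈ univ.erase a, h j (zs z) :=
        (expect_option_eq (fun u x => ((ν a x - 1) * ∏ j ∈ univ.erase a,
          h' j (Function.update x a u)) * ∏ j ∈ univ.erase a, h j x)).symm
    _ = 𝔼 z : Option ι → X, slfTop a ν z * ∏ j ∈ univ.erase a, slfFac a h h' j z := by
        refine Finset.expect_congr rfl fun z _ => ?_
        simp only [slfTop, slfFac, Finset.prod_mul_distrib]
        ring

/-- **Step 2: the weighted generalised von Neumann inequality** (Green–Tao 2010, Cor. B.4, the
`k - 1` successive applications of the Cauchy–Schwarz inequality of the source) applied to the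
family `slfFam`, majorised by `|ν_{-a} - 1|` on top and `μ_j μ'_j` on the faces.
[cite: ConlonFoxZhao2014, proof of Lemma 6.4] -/
theorem slf_gvn (a : ι) (hA : (dblSet a).Nonempty) {ν μ μ' h h' : ι → (ι → X) → ℝ}
    (hhdep : ∀ j, DependsOn (h j) ({j}ᶜ : Set ι)) (hh'dep : ∀ j, DependsOn (h' j) ({j}ᶜ : Set ι))
    (hμdep : ∀ j, DependsOn (μ j) ({j}ᶜ : Set ι)) (hμ'dep : ∀ j, DependsOn (μ' j) ({j}ᶜ : Set ι))
    (hh : ∀ j x, |h j x| ≤ μ j x) (hh' : ∀ j x, |h' j x| ≤ μ' j x) :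
    |𝔼 z : Option ι → X, slfTop a ν z * ∏ j ∈ univ.erase a, slfFac a h h' j z| ^
        2 ^ (dblSet a).card ≤
      Literature.NumberTheory.Sieve.wBoxPower (slfFam a (fun z => |slfTop a ν z|) (slfFac a μ μ')) (dblSet a) (slfTop a ν) *
        ∏ B ∈ (dblSet a).ssubsets, Literature.NumberTheory.Sieve.wBoxPower (slfFam a (fun z => |slfTop a ν z|) (slfFac a μ μ'))
          B (slfFam a (fun z => |slfTop a ν z|) (slfFac a μ μ') B) := by
  have hμnn : ∀ j x, 0 ≤ μ j x := fun j x => (abs_nonneg _).trans (hh j x)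
  have hμ'nn : ∀ j x, 0 ≤ μ' j x := fun j x => (abs_nonneg _).trans (hh' j x)
  have h1 := Literature.NumberTheory.Sieve.weightedGvN hA (slfFam a (slfTop a ν) (slfFac a h h'))
    (slfFam a (fun z => |slfTop a ν z|) (slfFac a μ μ'))
    (fun B hB => dependsOn_slfFam a _ _ (dependsOn_slfFac a hhdep hh'dep) B hB)
    (fun B hB => dependsOn_slfFam a _ _ (dependsOn_slfFac a hμdep hμ'dep) B hB)
    (fun B _ z => ?_) (fun B _ z => ?_)
  · simp_rw [prod_slfFam] at h1
    rwa [slfFam_top] at h1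
  · by_cases hB : B = dblSet a
    · rw [hB, slfFam_top]; exact abs_nonneg _
    · rw [slfFam_of_ne a _ _ hB, faceProd]
      exact Finset.prod_nonneg fun j _ => mul_nonneg (hμnn j _) (hμ'nn j _)
  · by_cases hB : B = dblSet a
    · rw [hB, slfFam_top, slfFam_top]
    · rw [slfFam_of_ne a _ _ hB, slfFam_of_ne a _ _ hB, faceProd, faceProd, Finset.abs_prod]
      refine Finset.prod_le_prod (fun j _ => abs_nonneg _) fun j _ => ?_
      rw [slfFac, slfFac, abs_mul]
      exact mul_le_mul (hh j _) (hh' j _) (abs_nonneg _) (hμnn j _)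

omit [Fintype X] [Nonempty X] in
/-- Regrouping the lower-order weights of the weighted box powers along the faces.
[folklore] -/
theorem prod_ssubsets_slfFam (a : ι) (T : (Option ι → X) → ℝ) (M : ι → (Option ι → X) → ℝ)
    (pt : Finset (Option ι) → Option ι → X) :
    ∏ C ∈ (dblSet a).ssubsets, ∏ ω ∈ C.powerset, slfFam a T M C (pt ω) =
      ∏ j ∈ univ.erase a, ∏ ω ∈ (faceOf a j).powerset, M j (pt ω) := by
  have hmaps : ∀ j ∈ univ.erase a, faceOf a j ∈ (dblSet a).ssubsets := fun j hj =>
    faceOf_mem_ssubsets (Finset.ne_of_mem_erase hj)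
  rw [← Finset.prod_fiberwise_of_maps_to hmaps]
  refine Finset.prod_congr rfl fun C hC => ?_
  have hCne : C ≠ dblSet a := (Finset.mem_ssubsets.mp hC).ne
  simp_rw [slfFam_of_ne a T M hCne, faceProd]
  rw [Finset.prod_comm]
  refine Finset.prod_congr rfl fun j hj => ?_
  rw [(Finset.mem_filter.mp hj).2]

omit [Fintype ι] [Fintype X] [Nonempty X] in
/-- The face weights at the transported mixed points: for `a ∉ ω`,
`(μ_j μ'_j)(x^{(ω)})` with the two copies of the `a`-coordinate read off `x⁽⁰⁾_a` and `x⁽¹⁾_a`.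
[folklore] -/
theorem slfFac_mixPt_thetaEquiv_symm (a : ι) (μ μ' : ι → (ι → X) → ℝ) (j : ι)
    (q : ((ι → X) × (ι → X)) × (X × X)) {ω : Finset ι} (hω : a ∉ ω) :
    slfFac a μ μ' j (Literature.NumberTheory.Sieve.mixPt ((thetaEquiv a).symm q).1 ((thetaEquiv a).symm q).2
        (ω.map Function.Embedding.some)) =
      μ j (Literature.NumberTheory.Sieve.mixPt q.1.1 q.1.2 ω) * μ' j (Literature.NumberTheory.Sieve.mixPt q.1.1 q.1.2 (insert a ω)) := by
  rw [slfFac, update_zs_mixPt_thetaEquiv_symm a q hω, zs_mixPt_thetaEquiv_symm a q hω]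

/-- **The transported face products are linear-forms averages**: for `S ⊆ {0,1}^{[k]∖{a}}` and
`J ⊆ [k] ∖ {a}`, the average over pairs of points of `X^{Option ι}` of
`∏_{ω ∈ S} ν_{-a}(zs x^{(ω)}) ∏_{j ∈ J} ∏_{ω ⊆ face_j} (μ_j μ'_j)(x^{(ω)})` is within `δ` of `1`.
[cite: ConlonFoxZhao2014, proof of Lemma 6.4] -/
theorem slf_faces_average {ν μ μ' : ι → (ι → X) → ℝ} {δ : ℝ} (hν : LFCWithin ν δ) (a : ι)
    (hμ : ∀ j, μ j = ν j ∨ μ j = fun _ => 1) (hμ' : ∀ j, μ' j = ν j ∨ μ' j = fun _ => 1)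
    {S : Finset (Finset ι)} (hS : S ⊆ (univ.erase a).powerset) {J : Finset ι}
    (hJ : J ⊆ univ.erase a) :
    |(𝔼 p : (Option ι → X) × (Option ι → X),
        (∏ ω ∈ S, ν a (zs (Literature.NumberTheory.Sieve.mixPt p.1 p.2 (ω.map Function.Embedding.some)))) *
          ∏ j ∈ J, ∏ ω ∈ ((univ.erase a).erase j).powerset,
            slfFac a μ μ' j (Literature.NumberTheory.Sieve.mixPt p.1 p.2 (ω.map Function.Embedding.some))) - 1| ≤ δ := by
  have hS1 : ∀ ω ∈ S, a ∉ ω := fun ω hω h => by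
    have := Finset.mem_powerset.mp (hS hω) h; simp at this
  set Ψ : (ι → X) × (ι → X) → ℝ := fun pp => (∏ ω ∈ S, ν a (Literature.NumberTheory.Sieve.mixPt pp.1 pp.2 ω)) *
    ∏ j ∈ J, ∏ ω ∈ ((univ.erase a).erase j).powerset,
      (μ j (Literature.NumberTheory.Sieve.mixPt pp.1 pp.2 ω) * μ' j (Literature.NumberTheory.Sieve.mixPt pp.1 pp.2 (insert a ω))) with hΨ
  rw [← Literature.NumberTheory.Sieve.expect_comp_equiv (thetaEquiv a).symm]
  have hpt : ∀ q : ((ι → X) × (ι → X)) × (X × X),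
      (∏ ω ∈ S, ν a (zs (Literature.NumberTheory.Sieve.mixPt ((thetaEquiv a).symm q).1 ((thetaEquiv a).symm q).2
          (ω.map Function.Embedding.some)))) *
        ∏ j ∈ J, ∏ ω ∈ ((univ.erase a).erase j).powerset,
          slfFac a μ μ' j (Literature.NumberTheory.Sieve.mixPt ((thetaEquiv a).symm q).1 ((thetaEquiv a).symm q).2
            (ω.map Function.Embedding.some)) = Ψ q.1 := by
    intro q
    simp only [hΨ]
    congr 1
    · exact Finset.prod_congr rfl fun ω hω => by rw [zs_mixPt_thetaEquiv_symm a q (hS1 ω hω)]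
    · refine Finset.prod_congr rfl fun j _ => Finset.prod_congr rfl fun ω hω => ?_
      have haω : a ∉ ω := fun h => by
        have := Finset.mem_powerset.mp hω h; simp at this
      exact slfFac_mixPt_thetaEquiv_symm a μ μ' j q haω
  have h1 : (𝔼 q : ((ι → X) × (ι → X)) × (X × X),
      (∏ ω ∈ S, ν a (zs (Literature.NumberTheory.Sieve.mixPt ((thetaEquiv a).symm q).1 ((thetaEquiv a).symm q).2
          (ω.map Function.Embedding.some)))) *
        ∏ j ∈ J, ∏ ω ∈ ((univ.erase a).erase j).powerset,
          slfFac a μ μ' j (Literature.NumberTheory.Sieve.mixPt ((thetaEquiv a).symm q).1 ((thetaEquiv a).symm q).2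
            (ω.map Function.Embedding.some))) =
      𝔼 q : ((ι → X) × (ι → X)) × (X × X), Ψ q.1 := Finset.expect_congr rfl fun q _ => hpt q
  rw [h1, Literature.NumberTheory.Sieve.expect_prod_fst]
  exact lfc_face_product hν a hμ hμ' hS hJ

/-- **Step 3: the top weighted box power is small**: expanding `∏_ω (ν_{-a}(x^{(ω)}) - 1)` into
an alternating sum of `2^{2^{k-1}}` linear-forms averages, each `1 + O(δ)`, the `1`'s cancel:
`|‖ν_{-a} - 1‖_{□(ν)}^{2^{k-1}}| ≤ 2^{2^{k-1}} δ`. [cite: ConlonFoxZhao2014, proof of Lemma 6.4] -/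
theorem slf_term1 {ν μ μ' : ι → (ι → X) → ℝ} {δ : ℝ} (hν : LFCWithin ν δ) (a : ι)
    (hμ : ∀ j, μ j = ν j ∨ μ j = fun _ => 1) (hμ' : ∀ j, μ' j = ν j ∨ μ' j = fun _ => 1)
    (T : (Option ι → X) → ℝ) :
    |Literature.NumberTheory.Sieve.wBoxPower (slfFam a T (slfFac a μ μ')) (dblSet a) (slfTop a ν)| ≤
      2 ^ 2 ^ (dblSet a).card * δ := by
  unfold Literature.NumberTheory.Sieve.wBoxPower
  simp_rw [prod_ssubsets_slfFam]
  -- pass to subsets of `[k] ∖ {a}`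
  have hA : dblSet a = (univ.erase a).map Function.Embedding.some := rfl
  simp_rw [faceOf_eq, prod_powerset_map, hA, prod_powerset_map]
  have key := abs_expect_prod_sub_one_mul_le (Ω := (Option ι → X) × (Option ι → X))
    (P := (univ.erase a).powerset) ⟨∅, Finset.empty_mem_powerset _⟩
    (fun ω p => ν a (zs (Literature.NumberTheory.Sieve.mixPt p.1 p.2 (ω.map Function.Embedding.some))))
    (fun p => ∏ j ∈ univ.erase a, ∏ ω ∈ ((univ.erase a).erase j).powerset,
      slfFac a μ μ' j (Literature.NumberTheory.Sieve.mixPt p.1 p.2 (ω.map Function.Embedding.some))) (δ := δ)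
    fun S hS => slf_faces_average hν a hμ hμ' hS Finset.Subset.rfl
  rw [Finset.card_powerset] at key
  rw [Finset.card_map]
  simp only [slfTop]
  exact key

/-- **Step 4: the lower weighted box powers are `1 + O(δ)`**: for `B ⊊ {some j : j ≠ a}` the
weighted box power of the majorant family is a linear-forms average over one face (or exactly `1`
below the faces), hence in `[0, 1 + δ]`. [cite: ConlonFoxZhao2014, proof of Lemma 6.4] -/
theorem slf_term2 {ν μ μ' : ι → (ι → X) → ℝ} {δ : ℝ} (hν : LFCWithin ν δ) (hδ : 0 ≤ δ) (a : ι)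
    (hμ : ∀ j, μ j = ν j ∨ μ j = fun _ => 1) (hμ' : ∀ j, μ' j = ν j ∨ μ' j = fun _ => 1)
    (hμnn : ∀ j x, 0 ≤ μ j x) (hμ'nn : ∀ j x, 0 ≤ μ' j x) (T : (Option ι → X) → ℝ)
    (hT : ∀ z, 0 ≤ T z) {B : Finset (Option ι)} (hB : B ∈ (dblSet a).ssubsets) :
    0 ≤ Literature.NumberTheory.Sieve.wBoxPower (slfFam a T (slfFac a μ μ')) B (slfFam a T (slfFac a μ μ') B) ∧
      Literature.NumberTheory.Sieve.wBoxPower (slfFam a T (slfFac a μ μ')) B (slfFam a T (slfFac a μ μ') B) ≤ 1 + δ := by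
  have hBne : B ≠ dblSet a := (Finset.mem_ssubsets.mp hB).ne
  have hMnn : ∀ j z, 0 ≤ slfFac a μ μ' j z := fun j z => mul_nonneg (hμnn j _) (hμ'nn j _)
  have hfam_nn : ∀ C z, 0 ≤ slfFam a T (slfFac a μ μ') C z := by
    intro C z
    by_cases hC : C = dblSet a
    · rw [hC, slfFam_top]; exact hT z
    · rw [slfFam_of_ne a _ _ hC, faceProd]; exact Finset.prod_nonneg fun j _ => hMnn j z
  refine ⟨Finset.expect_nonneg fun p _ => mul_nonneg (Finset.prod_nonneg fun ω _ => hfam_nn _ _)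
    (Finset.prod_nonneg fun C _ => Finset.prod_nonneg fun ω _ => hfam_nn _ _), ?_⟩
  -- the weights below `B` are `1`
  have hlow : ∀ C ∈ B.ssubsets, slfFam a T (slfFac a μ μ') C = fun _ => 1 := fun C hC => by
    rw [slfFam_of_ne a _ _ (fun h => ?_), faceProd_of_card_lt (card_lt_of_mem_ssubsets_ssubsets hB hC)]
    have h1 := card_lt_of_mem_ssubsets_ssubsets hB hC
    rw [h] at h1
    omega
  have hW : Literature.NumberTheory.Sieve.wBoxPower (slfFam a T (slfFac a μ μ')) B (slfFam a T (slfFac a μ μ') B) =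
      𝔼 p : (Option ι → X) × (Option ι → X), ∏ ω ∈ B.powerset,
        faceProd a (slfFac a μ μ') B (Literature.NumberTheory.Sieve.mixPt p.1 p.2 ω) := by
    unfold Literature.NumberTheory.Sieve.wBoxPower
    refine Finset.expect_congr rfl fun p _ => ?_
    have hss : ∏ C ∈ B.ssubsets, ∏ ω ∈ C.powerset,
        slfFam a T (slfFac a μ μ') C (Literature.NumberTheory.Sieve.mixPt p.1 p.2 ω) = 1 :=
      Finset.prod_eq_one fun C hC => by rw [hlow C hC]; simp
    rw [hss, mul_one, slfFam_of_ne a _ _ hBne]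
  rw [hW]
  by_cases hex : ∃ j ∈ univ.erase a, faceOf a j = B
  · obtain ⟨j, hj, rfl⟩ := hex
    have hja : j ≠ a := Finset.ne_of_mem_erase hj
    rw [faceProd_faceOf hja, faceOf_eq]
    simp only [prod_powerset_map]
    have h := slf_faces_average hν a hμ hμ' (S := ∅) (Finset.empty_subset _)
      (J := {j}) (Finset.singleton_subset_iff.mpr hj)
    simp only [Finset.prod_empty, one_mul, Finset.prod_singleton] at h
    linarith [(abs_le.mp h).2]
  · have hempty : faceProd a (slfFac a μ μ') B = fun _ => 1 := by
      funext z
      rw [faceProd, Finset.filter_eq_empty_iff.mpr fun j hj h => hex ⟨j, hj, h⟩, Finset.prod_empty]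
    rw [hempty]
    simp only [Finset.prod_const_one]
    rw [Finset.expect_const Finset.univ_nonempty]
    linarith

omit [Nonempty X] in
/-- `LFCWithin ν δ` forces `0 ≤ δ` (take the empty product). [folklore] -/
theorem LFCWithin.nonneg {ν : ι → (ι → X) → ℝ} {δ : ℝ} [Nonempty X] (hν : LFCWithin ν δ) :
    0 ≤ δ := by
  have h := hν ∅ (by simp)
  simp only [Finset.prod_empty] at h
  rw [Finset.expect_const Finset.univ_nonempty, sub_self, abs_zero] at h
  exact h

/-- **Strong linear forms (Lemma 6.4 for simplices, quantitative).** Let `ν` satisfy the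
`k`-linear forms condition within `δ ≤ 1`, `k ≥ 2`, and let `|h_j| ≤ μ_j`, `|h'_j| ≤ μ'_j` where
each majorant `μ_j, μ'_j` is `ν_{-j}` or `1` (the cases "`g ≤ ν`" and "`g̃ ≤ 1`" of the source),
all functions on `X_{-j}`. Then, with `h'(x_{-a}) = 𝔼_{x_a} ∏_{j ≠ a} h_j`, `h''` likewise,
`|𝔼[(ν_{-a} - 1) h' h'']|^{2^{k-1}} ≤ 4^{2^{k-1}} δ` — i.e. the factor `ν_{-a}` can be deleted at
cost `o(1)`. Proof: `k - 1` Cauchy–Schwarz steps in the packaged form of the weighted generalised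
von Neumann inequality (`Literature.NumberTheory.Sieve.weightedGvN`), then the linear forms condition for each resulting
average. [cite: ConlonFoxZhao2014, Lemma 6.4 and Section 6 (proof of Theorem 6.5)] -/
theorem slf {ν μ μ' h h' : ι → (ι → X) → ℝ} {δ : ℝ} (hν : LFCWithin ν δ) (hδ1 : δ ≤ 1) (a : ι)
    (hk : 2 ≤ Fintype.card ι) (hνdep : ∀ j, DependsOn (ν j) ({j}ᶜ : Set ι))
    (hμ : ∀ j, μ j = ν j ∨ μ j = fun _ => 1) (hμ' : ∀ j, μ' j = ν j ∨ μ' j = fun _ => 1)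
    (hhdep : ∀ j, DependsOn (h j) ({j}ᶜ : Set ι)) (hh'dep : ∀ j, DependsOn (h' j) ({j}ᶜ : Set ι))
    (hh : ∀ j x, |h j x| ≤ μ j x) (hh' : ∀ j x, |h' j x| ≤ μ' j x) :
    |𝔼 x, (ν a x - 1) * (dens a h x * dens a h' x)| ^ 2 ^ (Fintype.card ι - 1) ≤
      4 ^ 2 ^ (Fintype.card ι - 1) * δ := by
  have hδ0 : 0 ≤ δ := hν.nonneg
  have hA : (dblSet a).Nonempty := by
    rw [← Finset.card_pos, card_dblSet]
    omega
  have hdep_of : ∀ m : ι → (ι → X) → ℝ, (∀ j, m j = ν j ∨ m j = fun _ => 1) →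
      ∀ j, DependsOn (m j) ({j}ᶜ : Set ι) := by
    intro m hm j
    rcases hm j with h | h
    · rw [h]; exact hνdep j
    · rw [h]; exact fun _ _ _ => rfl
  have hμnn : ∀ j x, 0 ≤ μ j x := fun j x => (abs_nonneg _).trans (hh j x)
  have hμ'nn : ∀ j x, 0 ≤ μ' j x := fun j x => (abs_nonneg _).trans (hh' j x)
  rw [slf_expect_eq a (hνdep a), ← card_dblSet a]
  have h1 := slf_gvn a hA (ν := ν) hhdep hh'dep (hdep_of μ hμ) (hdep_of μ' hμ') hh hh'
  have h2 := slf_term1 hν a hμ hμ' (fun z => |slfTop a ν z|)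
  have h3 := fun (B : Finset (Option ι)) (hB : B ∈ (dblSet a).ssubsets) =>
    slf_term2 hν hδ0 a hμ hμ' hμnn hμ'nn (fun z => |slfTop a ν z|) (fun z => abs_nonneg _) hB
  have hprod_nn : 0 ≤ ∏ B ∈ (dblSet a).ssubsets,
      Literature.NumberTheory.Sieve.wBoxPower (slfFam a (fun z => |slfTop a ν z|) (slfFac a μ μ')) B
        (slfFam a (fun z => |slfTop a ν z|) (slfFac a μ μ') B) :=
    Finset.prod_nonneg fun B hB => (h3 B hB).1
  have hprod_le : ∏ B ∈ (dblSet a).ssubsets,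
      Literature.NumberTheory.Sieve.wBoxPower (slfFam a (fun z => |slfTop a ν z|) (slfFac a μ μ')) B
        (slfFam a (fun z => |slfTop a ν z|) (slfFac a μ μ') B) ≤ 2 ^ 2 ^ (dblSet a).card := by
    refine (Finset.prod_le_prod (fun B hB => (h3 B hB).1)
      (fun B hB => ((h3 B hB).2.trans (by linarith : 1 + δ ≤ 2)))).trans ?_
    rw [Finset.prod_const]
    refine pow_le_pow_right₀ (by norm_num) ?_
    rw [← Finset.card_powerset]
    exact Finset.card_le_card (Finset.erase_subset _ _)
  calc |𝔼 z : Option ι → X, slfTop a ν z * ∏ j ∈ univ.erase a, slfFac a h h' j z| ^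
        2 ^ (dblSet a).card
      ≤ _ := h1
    _ ≤ |Literature.NumberTheory.Sieve.wBoxPower (slfFam a (fun z => |slfTop a ν z|) (slfFac a μ μ')) (dblSet a) (slfTop a ν)| *
          ∏ B ∈ (dblSet a).ssubsets,
            Literature.NumberTheory.Sieve.wBoxPower (slfFam a (fun z => |slfTop a ν z|) (slfFac a μ μ')) B
              (slfFam a (fun z => |slfTop a ν z|) (slfFac a μ μ') B) :=
        mul_le_mul_of_nonneg_right (le_abs_self _) hprod_nn
    _ ≤ (2 ^ 2 ^ (dblSet a).card * δ) * 2 ^ 2 ^ (dblSet a).card :=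
        mul_le_mul h2 hprod_le hprod_nn (by positivity)
    _ = 4 ^ 2 ^ (dblSet a).card * δ := by
        rw [mul_comm, ← mul_assoc, ← mul_pow]
        norm_num

end SLFMain

end Literature.Combinatorics.Additive.CFZ
namespace Literature.Combinatorics.Additive.CFZ

/-! ## Proof of Theorem 6.5: the induction on the number of non-trivial weights -/

section Induction

variable {ι : Type} [Fintype ι] [DecidableEq ι]

/-- The counting estimate with explicit constants for weight systems that are `1` outside a set
`T` of at most `m` indices: the body of the inductive statement of the proof of Theorem 6.5
("induction on the number of `ν_{-1}, …, ν_{-k}` which are not identically `1`").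
[cite: ConlonFoxZhao2014, proof of Theorem 6.5] -/
def CountingBd (ι : Type) [Fintype ι] [DecidableEq ι] (m : ℕ) (ε δ : ℝ) : Prop :=
  ∀ (X : Type) [Fintype X] [Nonempty X] (ν g g' : ι → (ι → X) → ℝ) (T : Finset ι),
    T.card ≤ m → (∀ j, j ∉ T → ν j = fun _ => 1) →
    (∀ j, DependsOn (ν j) ({j}ᶜ : Set ι)) → (∀ j, DependsOn (g j) ({j}ᶜ : Set ι)) →
    (∀ j, DependsOn (g' j) ({j}ᶜ : Set ι)) →
    (∀ j x, 0 ≤ g j x) → (∀ j x, g j x ≤ ν j x) → (∀ j x, 0 ≤ g' j x) → (∀ j x, g' j x ≤ 1) →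
    LFCWithin ν δ → (∀ j, HasSmallCut (univ.erase j) (fun x => g j x - g' j x) δ) →
    |𝔼 x : ι → X, (∏ j, g j x - ∏ j, g' j x)| ≤ ε

/-- The inductive statement `P(m)` of the proof of Theorem 6.5: the relative counting lemma, in
`ε`–`δ` form, for weight systems with at most `m` weights not identically `1`.
[cite: ConlonFoxZhao2014, proof of Theorem 6.5] -/
def CountingInd (ι : Type) [Fintype ι] [DecidableEq ι] (m : ℕ) : Prop :=
  ∀ ε : ℝ, 0 < ε → ∃ δ : ℝ, 0 < δ ∧ CountingBd ι m ε δ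

/-- **Base of the induction** ("when `ν = 1`, we are in the dense setting"): Proposition 6.1
for simplices. [cite: ConlonFoxZhao2014, proof of Theorem 6.5, Proposition 6.1] -/
theorem countingInd_zero : CountingInd ι 0 := by
  intro ε hε
  refine ⟨ε / (Fintype.card ι + 1), by positivity, ?_⟩
  intro X _ _ ν g g' T hT hνT _ hgdep hg'dep hg0 hgν hg'0 hg'1 _ hcut
  have hT0 : T = ∅ := Finset.card_eq_zero.mp (Nat.le_zero.mp hT)
  have hν1 : ∀ j, ν j = fun _ => 1 := fun j => hνT j (by simp [hT0])
  have hg1 : ∀ j x, g j x ≤ 1 := fun j x => by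
    have := hgν j x
    rw [hν1 j] at this
    exact this
  refine (dense_counting hgdep hg'dep (fun j x => ⟨hg0 j x, hg1 j x⟩)
    (fun j x => ⟨hg'0 j x, hg'1 j x⟩) hcut).trans ?_
  calc (Fintype.card ι : ℝ) * (ε / (Fintype.card ι + 1))
      = ε * (Fintype.card ι / (Fintype.card ι + 1)) := by ring
    _ ≤ ε * 1 :=
        mul_le_mul_of_nonneg_left ((div_le_one (by positivity)).mpr (by linarith)) hε.le
    _ = ε := mul_one ε

variable {X : Type} [Fintype X] [Nonempty X]

omit [Fintype X] [Nonempty X] in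
/-- Products with one factor replaced. [folklore] -/
theorem prod_update_apply (g : ι → (ι → X) → ℝ) (a : ι) (F : (ι → X) → ℝ) (x : ι → X) :
    ∏ j, Function.update g a F j x = F x * ∏ j ∈ univ.erase a, g j x := by
  rw [← Finset.mul_prod_erase univ (fun j => Function.update g a F j x) (Finset.mem_univ a),
    Function.update_self]
  congr 1
  exact Finset.prod_congr rfl fun j hj => by rw [Function.update_of_ne (Finset.ne_of_mem_erase hj)]

/-- **Using the induction hypothesis after densification**: replace `ν_{-a}, g_{-a}, g̃_{-a}` by
`1, F, F'` with `0 ≤ F, F' ≤ 1` functions on `X_{-a}`, `‖F - F'‖_□ ≤ δ_c` ("replace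
`ν_{XY}, g_{XY}, g̃_{XY}` by `1, 1_{A×B}, 1_{A×B}`" resp. "by `1, g'_{∧1}, g̃'`", "and note that this
increases the number of weights which are identically `1`").
[cite: ConlonFoxZhao2014, proof of Theorem 6.2, (6.8)–(6.9)] -/
theorem CountingBd.replace {m : ℕ} {ε δc : ℝ} (H : CountingBd ι m ε δc)
    {ν g g' : ι → (ι → X) → ℝ} {T : Finset ι} {a : ι} {δ : ℝ}
    (hT : (T.erase a).card ≤ m) (hνT : ∀ j, j ∉ T → ν j = fun _ => 1)
    (hνdep : ∀ j, DependsOn (ν j) ({j}ᶜ : Set ι)) (hgdep : ∀ j, DependsOn (g j) ({j}ᶜ : Set ι))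
    (hg'dep : ∀ j, DependsOn (g' j) ({j}ᶜ : Set ι))
    (hg0 : ∀ j x, 0 ≤ g j x) (hgν : ∀ j x, g j x ≤ ν j x) (hg'0 : ∀ j x, 0 ≤ g' j x)
    (hg'1 : ∀ j x, g' j x ≤ 1) (hL : LFCWithin ν δ)
    (hcut : ∀ j, HasSmallCut (univ.erase j) (fun x => g j x - g' j x) δ) (hδ : δ ≤ δc)
    {F F' : (ι → X) → ℝ} (hFdep : DependsOn F ({a}ᶜ : Set ι))
    (hF'dep : DependsOn F' ({a}ᶜ : Set ι)) (hF0 : ∀ x, 0 ≤ F x) (hF1 : ∀ x, F x ≤ 1)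
    (hF'0 : ∀ x, 0 ≤ F' x) (hF'1 : ∀ x, F' x ≤ 1)
    (hFcut : HasSmallCut (univ.erase a) (fun x => F x - F' x) δc) :
    |(𝔼 x, F x * ∏ j ∈ univ.erase a, g j x) - 𝔼 x, F' x * ∏ j ∈ univ.erase a, g' j x| ≤ ε := by
  have h := H X (Function.update ν a fun _ => 1) (Function.update g a F)
    (Function.update g' a F') (T.erase a) hT ?_ ?_ ?_ ?_ ?_ ?_ ?_ ?_ ((hL.update_one a).mono hδ) ?_
  · simpa only [prod_update_apply, Finset.expect_sub_distrib] using h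
  · intro j hj
    by_cases hja : j = a
    · rw [hja, Function.update_self]
    · rw [Function.update_of_ne hja]
      exact hνT j fun h => hj (Finset.mem_erase.mpr ⟨hja, h⟩)
  · intro j
    by_cases hja : j = a
    · rw [hja, Function.update_self]; exact fun _ _ _ => rfl
    · rw [Function.update_of_ne hja]; exact hνdep j
  · intro j
    by_cases hja : j = a
    · rw [hja, Function.update_self]; exact hFdep
    · rw [Function.update_of_ne hja]; exact hgdep j
  · intro j
    by_cases hja : j = a
    · rw [hja, Function.update_self]; exact hF'dep
    · rw [Function.update_of_ne hja]; exact hg'dep j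
  · intro j x
    by_cases hja : j = a
    · rw [hja, Function.update_self]; exact hF0 x
    · rw [Function.update_of_ne hja]; exact hg0 j x
  · intro j x
    by_cases hja : j = a
    · rw [hja, Function.update_self, Function.update_self]; exact hF1 x
    · rw [Function.update_of_ne hja, Function.update_of_ne hja]; exact hgν j x
  · intro j x
    by_cases hja : j = a
    · rw [hja, Function.update_self]; exact hF'0 x
    · rw [Function.update_of_ne hja]; exact hg'0 j x
  · intro j x
    by_cases hja : j = a
    · rw [hja, Function.update_self]; exact hF'1 x
    · rw [Function.update_of_ne hja]; exact hg'1 j x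
  · intro j
    by_cases hja : j = a
    · rw [hja]; simp only [Function.update_self]; exact hFcut
    · simp only [Function.update_of_ne hja]; exact (hcut j).mono hδ

omit [Nonempty X] in
/-- Weighted Cauchy–Schwarz: `(𝔼 w φ)² ≤ 𝔼 w φ² · 𝔼 w` for `w ≥ 0`. [folklore] -/
theorem expect_mul_sq_le_of_nonneg {Ω : Type*} [Fintype Ω] (w φ : Ω → ℝ) (hw : ∀ x, 0 ≤ w x) :
    (𝔼 x, w x * φ x) ^ 2 ≤ (𝔼 x, w x * φ x ^ 2) * 𝔼 x, w x := by
  have h := Finset.expect_mul_sq_le_sq_mul_sq univ (fun x => Real.sqrt (w x) * φ x)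
    (fun x => Real.sqrt (w x))
  have e1 : ∀ x, Real.sqrt (w x) * φ x * Real.sqrt (w x) = w x * φ x := fun x => by
    rw [mul_comm, ← mul_assoc, Real.mul_self_sqrt (hw x)]
  have e2 : ∀ x, (Real.sqrt (w x) * φ x) ^ 2 = w x * φ x ^ 2 := fun x => by
    rw [mul_pow, Real.sq_sqrt (hw x)]
  have e3 : ∀ x, Real.sqrt (w x) ^ 2 = w x := fun x => Real.sq_sqrt (hw x)
  simp only [e1, e2, e3] at h
  exact h

omit [Nonempty X] in
/-- `(𝔼 |f|)² ≤ 𝔼 f²`. [folklore] -/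
theorem expect_abs_sq_le {Ω : Type*} [Fintype Ω] [Nonempty Ω] (f : Ω → ℝ) :
    (𝔼 x, |f x|) ^ 2 ≤ 𝔼 x, f x ^ 2 := by
  have h := expect_mul_sq_le_of_nonneg (fun _ => (1 : ℝ)) (fun x => |f x|) fun _ => zero_le_one
  simp only [one_mul, sq_abs] at h
  rwa [Finset.expect_const Finset.univ_nonempty, mul_one] at h

end Induction

end Literature.Combinatorics.Additive.CFZ
namespace Literature.Combinatorics.Additive.CFZ

section Step

variable {ι : Type} [Fintype ι] [DecidableEq ι]

/-- **The induction step of the proof of Theorem 6.5** (densification): `P(m) ⟹ P(m+1)` for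
`k ≥ 2`. Given at most `m + 1` non-trivial weights, pick one, `ν_{-a}`; with the densified
`ν' = 𝔼_{x_a} ∏_{j≠a} ν_{-j}`, `g'`, `g̃'` and the cap `g'_{∧1} = min(g', 1)`:
(6.2) `𝔼[∏ g] - 𝔼[∏ g̃] = 𝔼[g_{-a}(g' - g̃')] + 𝔼[(g_{-a} - g̃_{-a}) g̃']`, the second term being
at most `‖g_{-a} - g̃_{-a}‖_□`; Cauchy–Schwarz and the strong linear forms estimate reduce the
first to `𝔼[(g' - g̃')²]` (6.3); `𝔼[(ν'-1)²] = O(δ)` (6.4); the split (6.6) with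
`0 ≤ g' - g'_{∧1} ≤ |ν' - 1|` (6.7); `‖g'_{∧1} - g̃'‖_□ = o(1)` (6.8) and the three terms of (6.9)
by the induction hypothesis applied to the system with `ν_{-a}` replaced by `1`.
[cite: ConlonFoxZhao2014, proof of Theorem 6.2 and of Theorem 6.5] -/
theorem countingInd_succ (hk : 2 ≤ Fintype.card ι) {m : ℕ} (ih : CountingInd ι m) :
    CountingInd ι (m + 1) := by
  intro ε hε
  -- the constants
  obtain ⟨δ₀, hδ₀, H₀⟩ := ih ε hε
  obtain ⟨δ₂', hδ₂', H₂⟩ := ih (ε ^ 2 / 80) (by positivity)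
  set δ₂ : ℝ := min δ₂' (ε ^ 2 / 20) with hδ₂
  have hδ₂0 : 0 < δ₂ := lt_min hδ₂' (by positivity)
  have hδ₂le : δ₂ ≤ δ₂' := min_le_left _ _
  have hδ₂ε : δ₂ ≤ ε ^ 2 / 20 := min_le_right _ _
  obtain ⟨δ₁, hδ₁, H₁⟩ := ih (δ₂ / 2) (by positivity)
  set τ : ℝ := min (δ₂ / 2) (ε ^ 2 / 120) with hτ
  have hτ0 : 0 < τ := lt_min (by positivity) (by positivity)
  have hτδ₂ : τ ≤ δ₂ / 2 := min_le_left _ _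
  have hτε : τ ≤ ε ^ 2 / 120 := min_le_right _ _
  set σ : ℝ := ε ^ 2 / 160 with hσ
  have hσ0 : 0 < σ := by positivity
  set n : ℕ := Fintype.card ι - 1 with hn
  set δ : ℝ := min (min (min (min 1 (ε / 2)) (min (ε ^ 2 / 120) (τ ^ 2 / 3)))
    (min ((σ / 4) ^ 2 ^ n) δ₁)) (min δ₂ δ₀) with hδdef
  have hδpos : 0 < δ := by
    simp only [hδdef, lt_min_iff]
    exact ⟨⟨⟨⟨one_pos, by positivity⟩, by positivity, by positivity⟩, by positivity, hδ₁⟩, hδ₂0, hδ₀⟩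
  have hδ1 : δ ≤ 1 := by simp only [hδdef, min_le_iff, le_refl, true_or]
  have hδε : δ ≤ ε / 2 := by simp only [hδdef, min_le_iff, le_refl, true_or, or_true]
  have hδε2 : δ ≤ ε ^ 2 / 120 := by simp only [hδdef, min_le_iff, le_refl, true_or, or_true]
  have hδτ : δ ≤ τ ^ 2 / 3 := by simp only [hδdef, min_le_iff, le_refl, true_or, or_true]
  have hδσ : δ ≤ (σ / 4) ^ 2 ^ n := by simp only [hδdef, min_le_iff, le_refl, true_or, or_true]
  have hδδ₁ : δ ≤ δ₁ := by simp only [hδdef, min_le_iff, le_refl, true_or, or_true]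
  have hδδ₂ : δ ≤ δ₂ := by simp only [hδdef, min_le_iff, le_refl, true_or, or_true]
  have hδδ₀ : δ ≤ δ₀ := by simp only [hδdef, min_le_iff, le_refl, or_true]
  refine ⟨δ, hδpos, ?_⟩
  intro X _ _ ν g g' T hT hνT hνdep hgdep hg'dep hg0 hgν hg'0 hg'1 hL hcut
  -- at most `m` non-trivial weights: the induction hypothesis applies directly
  by_cases hTm : T.card ≤ m
  · exact H₀ X ν g g' T hTm hνT hνdep hgdep hg'dep hg0 hgν hg'0 hg'1 (hL.mono hδδ₀)
      fun j => (hcut j).mono hδδ₀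
  -- otherwise pick a non-trivial weight `ν_{-a}`
  have hTne : T.Nonempty := by
    rw [← Finset.card_pos]
    omega
  obtain ⟨a, ha⟩ := hTne
  have hT' : (T.erase a).card ≤ m := by
    rw [Finset.card_erase_of_mem ha]
    omega
  have hνnn : ∀ j x, 0 ≤ ν j x := fun j x => (hg0 j x).trans (hgν j x)
  -- the densified weights `ν' = V`, `g' = G`, `g̃' = G'` and the cap `g'_{∧1} = Gc`
  set V : (ι → X) → ℝ := dens a ν with hV
  set G : (ι → X) → ℝ := dens a g with hG
  set G' : (ι → X) → ℝ := dens a g' with hG'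
  set Gc : (ι → X) → ℝ := fun x => min (G x) 1 with hGc
  have hG0 : ∀ x, 0 ≤ G x := dens_nonneg hg0
  have hGV : ∀ x, G x ≤ V x := dens_mono hg0 hgν
  have hG'0 : ∀ x, 0 ≤ G' x := dens_nonneg hg'0
  have hG'1 : ∀ x, G' x ≤ 1 := dens_le_one hg'0 hg'1
  have hGc0 : ∀ x, 0 ≤ Gc x := fun x => le_min (hG0 x) zero_le_one
  have hGc1 : ∀ x, Gc x ≤ 1 := fun x => min_le_right _ _
  have hGcG : ∀ x, Gc x ≤ G x := fun x => min_le_left _ _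
  have hVdep : DependsOn V ({a}ᶜ : Set ι) := dependsOn_dens a ν
  have hGdep : DependsOn G ({a}ᶜ : Set ι) := dependsOn_dens a g
  have hG'dep : DependsOn G' ({a}ᶜ : Set ι) := dependsOn_dens a g'
  have hGcdep : DependsOn Gc ({a}ᶜ : Set ι) := fun x y hxy => by simp only [hGc, hGdep hxy]
  have hgsub_dep : DependsOn (fun x => g a x - g' a x) ({a}ᶜ : Set ι) := fun x y hxy => by
    simp only [hgdep a hxy, hg'dep a hxy]
  -- (6.2): `𝔼 ∏ g - 𝔼 ∏ g̃ = 𝔼 g_a (G - G') + 𝔼 (g_a - g̃_a) G'`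
  have hsplit : (𝔼 x, (∏ j, g j x - ∏ j, g' j x)) =
      (𝔼 x, g a x * (G x - G' x)) + 𝔼 x, (g a x - g' a x) * G' x := by
    rw [Finset.expect_sub_distrib, expect_prod_eq_expect_mul_dens a (hgdep a),
      expect_prod_eq_expect_mul_dens a (hg'dep a), ← Finset.expect_sub_distrib,
      ← Finset.expect_add_distrib]
    exact Finset.expect_congr rfl fun x _ => by ring
  -- the second term of (6.2) is at most `‖g_a - g̃_a‖_□ ≤ δ`
  have h3 : |𝔼 x, (g a x - g' a x) * G' x| ≤ δ := by
    rw [hG', ← expect_mul_prod_erase_eq a hgsub_dep g']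
    exact abs_expect_mul_prod_erase_le hgsub_dep (hcut a) g' (fun j x => ⟨hg'0 j x, hg'1 j x⟩)
      hg'dep
  -- the strong linear forms estimates
  have hroot : ∀ S : ℝ, |S| ^ 2 ^ n ≤ 4 ^ 2 ^ n * δ → |S| ≤ σ := by
    intro S hS
    have h1 : |S| ^ 2 ^ n ≤ σ ^ 2 ^ n := by
      refine hS.trans ?_
      calc (4 : ℝ) ^ 2 ^ n * δ ≤ 4 ^ 2 ^ n * (σ / 4) ^ 2 ^ n :=
            mul_le_mul_of_nonneg_left hδσ (by positivity)
        _ = σ ^ 2 ^ n := by rw [← mul_pow]; congr 1; ring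
    exact (pow_le_pow_iff_left₀ (abs_nonneg S) hσ0.le (pow_ne_zero _ two_ne_zero)).mp h1
  have hone : ∀ j : ι, (fun _ : ι → X => (1 : ℝ)) = ν j ∨ (fun _ : ι → X => (1 : ℝ)) = fun _ => 1 :=
    fun j => Or.inr rfl
  have hg_abs : ∀ j x, |g j x| ≤ ν j x := fun j x => by rw [abs_of_nonneg (hg0 j x)]; exact hgν j x
  have hg'_abs : ∀ j x, |g' j x| ≤ (fun _ : ι → X => (1 : ℝ)) x := fun j x => by
    rw [abs_of_nonneg (hg'0 j x)]; exact hg'1 j x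
  have hS1 : |𝔼 x, (ν a x - 1) * (G x * G x)| ≤ σ :=
    hroot _ (slf hL hδ1 a hk hνdep (fun j => Or.inl rfl) (fun j => Or.inl rfl) hgdep hgdep
      hg_abs hg_abs)
  have hS2 : |𝔼 x, (ν a x - 1) * (G x * G' x)| ≤ σ :=
    hroot _ (slf hL hδ1 a hk hνdep (fun j => Or.inl rfl) hone hgdep hg'dep hg_abs hg'_abs)
  have hS3 : |𝔼 x, (ν a x - 1) * (G' x * G' x)| ≤ σ :=
    hroot _ (slf hL hδ1 a hk hνdep hone hone hg'dep hg'dep hg'_abs hg'_abs)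
  -- (6.3): Cauchy–Schwarz and deletion of the factor `ν_a`
  have h4 : (𝔼 x, g a x * (G x - G' x)) ^ 2 ≤
      (𝔼 x, ν a x * (G x - G' x) ^ 2) * 𝔼 x, ν a x := by
    refine (expect_mul_sq_le_of_nonneg (g a) (fun x => G x - G' x) (hg0 a)).trans ?_
    refine mul_le_mul (Finset.expect_le_expect fun x _ => ?_) (Finset.expect_le_expect fun x _ =>
      hgν a x) (Finset.expect_nonneg fun x _ => hg0 a x) (Finset.expect_nonneg fun x _ => ?_)
    · exact mul_le_mul_of_nonneg_right (hgν a x) (sq_nonneg _)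
    · exact mul_nonneg (hνnn a x) (sq_nonneg _)
  have h5 : (𝔼 x, ν a x) ≤ 1 + δ := hL.expect_le a
  have h6 : (𝔼 x, ν a x * (G x - G' x) ^ 2) ≤ (𝔼 x, (G x - G' x) ^ 2) + 4 * σ := by
    have he : (𝔼 x, ν a x * (G x - G' x) ^ 2) = (𝔼 x, (G x - G' x) ^ 2) +
        ((𝔼 x, (ν a x - 1) * (G x * G x)) - 2 * (𝔼 x, (ν a x - 1) * (G x * G' x)) +
          𝔼 x, (ν a x - 1) * (G' x * G' x)) := by
      rw [Finset.mul_expect, ← Finset.expect_sub_distrib, ← Finset.expect_add_distrib,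
        ← Finset.expect_add_distrib]
      exact Finset.expect_congr rfl fun x _ => by ring
    rw [he]
    have := abs_le.mp hS1
    have := abs_le.mp hS2
    have := abs_le.mp hS3
    linarith
  -- (6.4): `𝔼 (ν' - 1)² ≤ 3δ`, `𝔼 |ν' - 1| ≤ τ`
  have hV1 : |(𝔼 x, V x) - 1| ≤ δ := abs_expect_dens_sub_one_le hL a
  have hV2 : (𝔼 x, V x ^ 2) ≤ 1 + δ := expect_dens_sq_le hL a
  have hV3 : (𝔼 x, (V x - 1) ^ 2) ≤ 3 * δ := by
    have he : (𝔼 x, (V x - 1) ^ 2) = (𝔼 x, V x ^ 2) - 2 * (𝔼 x, V x) + 1 := by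
      have : (𝔼 x : ι → X, (V x - 1) ^ 2) = 𝔼 x, (V x ^ 2 - 2 * V x + 1) :=
        Finset.expect_congr rfl fun x _ => by ring
      rw [this, Finset.expect_add_distrib, Finset.expect_sub_distrib,
        Finset.expect_const Finset.univ_nonempty, ← Finset.mul_expect]
    rw [he]
    have := abs_le.mp hV1
    linarith
  have hV4 : (𝔼 x, |V x - 1|) ≤ τ := by
    have h1 : (𝔼 x, |V x - 1|) ^ 2 ≤ τ ^ 2 :=
      (expect_abs_sq_le fun x => V x - 1).trans (by linarith)
    exact (abs_le_of_sq_le_sq' h1 hτ0.le).2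
  -- (6.7): `0 ≤ g' - g'_{∧1} ≤ |ν' - 1|`
  have h8 : ∀ x, 0 ≤ G x - Gc x ∧ G x - Gc x ≤ |V x - 1| := by
    intro x
    refine ⟨sub_nonneg.mpr (hGcG x), ?_⟩
    simp only [hGc]
    rcases le_total (G x) 1 with h | h
    · rw [min_eq_left h, sub_self]; exact abs_nonneg _
    · rw [min_eq_right h]
      exact (sub_le_sub_right (hGV x) 1).trans (le_abs_self _)
  -- first term of (6.6)
  have h10 : |𝔼 x, (G x - G' x) * (G x - Gc x)| ≤ 3 * δ + 2 * τ := by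
    refine (Finset.abs_expect_le _ _).trans ?_
    have hpt : ∀ x, |(G x - G' x) * (G x - Gc x)| ≤ (V x - 1) ^ 2 + 2 * |V x - 1| := by
      intro x
      rw [abs_mul, abs_of_nonneg (h8 x).1]
      have hGG' : |G x - G' x| ≤ V x + 1 := by
        rw [abs_le]
        constructor <;> linarith [hG0 x, hGV x, hG'0 x, hG'1 x]
      calc |G x - G' x| * (G x - Gc x) ≤ (V x + 1) * |V x - 1| :=
            mul_le_mul hGG' (h8 x).2 (h8 x).1 (by linarith [hG0 x, hGV x])
        _ = (V x - 1) * |V x - 1| + 2 * |V x - 1| := by ring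
        _ ≤ |V x - 1| * |V x - 1| + 2 * |V x - 1| :=
            add_le_add (mul_le_mul_of_nonneg_right (le_abs_self _) (abs_nonneg _)) le_rfl
        _ = (V x - 1) ^ 2 + 2 * |V x - 1| := by rw [← sq, sq_abs]
    refine (Finset.expect_le_expect fun x _ => hpt x).trans ?_
    rw [Finset.expect_add_distrib, ← Finset.mul_expect]
    linarith
  -- (6.8): `‖g'_{∧1} - g̃'‖_□ ≤ τ + δ₂/2`
  have h11 : HasSmallCut (univ.erase a) (fun x => Gc x - G' x) (τ + δ₂ / 2) := by
    intro c hc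
    set P : (ι → X) → ℝ := fun x => ∏ l ∈ univ.erase a, c l x with hP
    have hP01 : ∀ x, 0 ≤ P x ∧ P x ≤ 1 := fun x =>
      ⟨Finset.prod_nonneg fun l _ => (hc.nonneg_le_one l x).1,
        Finset.prod_le_one (fun l _ => (hc.nonneg_le_one l x).1) fun l _ => (hc.nonneg_le_one l x).2⟩
    have hPdep : DependsOn P ({a}ᶜ : Set ι) := by
      intro x y hxy
      simp only [hP]
      refine Finset.prod_congr rfl fun l hl => hc.dependsOn l hl fun i hi => hxy i ?_
      have := Finset.mem_erase.mp (Finset.mem_coe.mp hi)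
      simpa using (Finset.mem_erase.mp this.2).1
    have hsplit' : cutAverage (univ.erase a) (fun x => Gc x - G' x) c =
        (𝔼 x, (Gc x - G x) * P x) +
          ((𝔼 x, P x * ∏ j ∈ univ.erase a, g j x) - 𝔼 x, P x * ∏ j ∈ univ.erase a, g' j x) := by
      rw [cutAverage, expect_mul_prod_erase_eq a hPdep g, expect_mul_prod_erase_eq a hPdep g',
        ← Finset.expect_sub_distrib, ← Finset.expect_add_distrib]
      exact Finset.expect_congr rfl fun x _ => by simp only [hP, hG, hG']; ring
    rw [hsplit']
    refine (abs_add_le _ _).trans (add_le_add ?_ ?_)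
    · refine (Finset.abs_expect_le _ _).trans ((Finset.expect_le_expect fun x _ => ?_).trans hV4)
      rw [abs_mul, abs_of_nonneg (hP01 x).1, abs_sub_comm, abs_of_nonneg (h8 x).1]
      exact (mul_le_of_le_one_right (h8 x).1 (hP01 x).2).trans (h8 x).2
    · refine H₁.replace hT' hνT hνdep hgdep hg'dep hg0 hgν hg'0 hg'1 hL hcut hδδ₁ hPdep hPdep
        (fun x => (hP01 x).1) (fun x => (hP01 x).2) (fun x => (hP01 x).1) (fun x => (hP01 x).2) ?_
      intro c' _
      simp only [sub_self, cutAverage, zero_mul]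
      rw [Finset.expect_const Finset.univ_nonempty, abs_zero]
      exact hδ₁.le
  have h11' : HasSmallCut (univ.erase a) (fun x => Gc x - G' x) δ₂' :=
    h11.mono (by linarith)
  -- second term of (6.6), via (6.9)
  have h12 : |𝔼 x, (G x - G' x) * (Gc x - G' x)| ≤ 2 * (ε ^ 2 / 80) + (τ + δ₂ / 2) := by
    have he : (𝔼 x, (G x - G' x) * (Gc x - G' x)) =
        ((𝔼 x, Gc x * ∏ j ∈ univ.erase a, g j x) - 𝔼 x, G' x * ∏ j ∈ univ.erase a, g' j x) -
        ((𝔼 x, G' x * ∏ j ∈ univ.erase a, g j x) - 𝔼 x, G' x * ∏ j ∈ univ.erase a, g' j x) -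
        𝔼 x, (Gc x - G' x) * ∏ j ∈ univ.erase a, g' j x := by
      rw [expect_mul_prod_erase_eq a hGcdep g, expect_mul_prod_erase_eq a hG'dep g',
        expect_mul_prod_erase_eq a hG'dep g,
        expect_mul_prod_erase_eq a (fun x y hxy => by simp only [hGcdep hxy, hG'dep hxy]) g',
        ← Finset.expect_sub_distrib, ← Finset.expect_sub_distrib, ← Finset.expect_sub_distrib,
        ← Finset.expect_sub_distrib]
      exact Finset.expect_congr rfl fun x _ => by simp only [hG, hG']; ring
    rw [he]
    have i1 := H₂.replace hT' hνT hνdep hgdep hg'dep hg0 hgν hg'0 hg'1 hL hcut (hδδ₂.trans hδ₂le)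
      hGcdep hG'dep hGc0 hGc1 hG'0 hG'1 h11'
    have i2 := H₂.replace hT' hνT hνdep hgdep hg'dep hg0 hgν hg'0 hg'1 hL hcut (hδδ₂.trans hδ₂le)
      hG'dep hG'dep hG'0 hG'1 hG'0 hG'1 (F := G') (F' := G') (fun c' _ => by
        simp only [sub_self, cutAverage, zero_mul]
        rw [Finset.expect_const Finset.univ_nonempty, abs_zero]
        exact hδ₂'.le)
    have i3 : |𝔼 x, (Gc x - G' x) * ∏ j ∈ univ.erase a, g' j x| ≤ τ + δ₂ / 2 :=
      abs_expect_mul_prod_erase_le (fun x y hxy => by simp only [hGcdep hxy, hG'dep hxy]) h11 g'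
        (fun j x => ⟨hg'0 j x, hg'1 j x⟩) hg'dep
    have := abs_le.mp i1
    have := abs_le.mp i2
    have := abs_le.mp i3
    rw [abs_le]
    constructor <;> linarith
  -- assembling (6.6)
  have hQ : (𝔼 x, (G x - G' x) ^ 2) ≤ 3 * δ + 2 * τ + (2 * (ε ^ 2 / 80) + (τ + δ₂ / 2)) := by
    have he : (𝔼 x, (G x - G' x) ^ 2) =
        (𝔼 x, (G x - G' x) * (G x - Gc x)) + 𝔼 x, (G x - G' x) * (Gc x - G' x) := by
      rw [← Finset.expect_add_distrib]
      exact Finset.expect_congr rfl fun x _ => by ring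
    rw [he]
    have := abs_le.mp h10
    have := abs_le.mp h12
    linarith
  have hmain : |𝔼 x, g a x * (G x - G' x)| ≤ ε / 2 := by
    refine abs_le_of_sq_le_sq (h4.trans ?_) (by positivity)
    have hA0 : 0 ≤ 𝔼 x, ν a x * (G x - G' x) ^ 2 :=
      Finset.expect_nonneg fun x _ => mul_nonneg (hνnn a x) (sq_nonneg _)
    calc (𝔼 x, ν a x * (G x - G' x) ^ 2) * 𝔼 x, ν a x
        ≤ ((𝔼 x, (G x - G' x) ^ 2) + 4 * σ) * (1 + δ) :=
          mul_le_mul h6 h5 (Finset.expect_nonneg fun x _ => hνnn a x) (hA0.trans h6)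
      _ ≤ (ε ^ 2 / 8) * 2 := by
          refine mul_le_mul ?_ (by linarith) (by linarith) (by positivity)
          nlinarith [sq_nonneg ε]
      _ = (ε / 2) ^ 2 := by ring
  rw [hsplit]
  refine (abs_add_le _ _).trans ?_
  linarith

end Step

/-! ## Theorem 6.5 -/

/-- `P(m)` for all `m`, for `k ≥ 2`. [cite: ConlonFoxZhao2014, proof of Theorem 6.5] -/
theorem countingInd_all {ι : Type} [Fintype ι] [DecidableEq ι] (hk : 2 ≤ Fintype.card ι) :
    ∀ m, CountingInd ι m
  | 0 => countingInd_zero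
  | m + 1 => countingInd_succ hk (countingInd_all hk m)

/-- **Conlon–Fox–Zhao, Theorem 6.5 (relative simplex counting lemma), proved**: the named fact
`CFZ.RelativeCounting` holds. For `k ≤ 1` directly; for `k ≥ 2` by the induction
`countingInd_zero` / `countingInd_succ` on the number of weights not identically `1`, run up to
`m = k`. [cite: ConlonFoxZhao2014, Theorem 6.5] -/
theorem relativeCounting_holds : RelativeCounting := by
  intro k ε hε
  by_cases hk : 2 ≤ k
  · obtain ⟨δ, hδ, H⟩ := countingInd_all (ι := Fin k) (by simpa using hk) k ε hε
    refine ⟨δ, hδ, ?_⟩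
    intro X _ _ ν g g' hνdep hgdep hg'dep hg0 hgν hg'0 hg'1 hL hcut
    exact H X ν g g' univ (by simp) (fun j hj => absurd (Finset.mem_univ j) hj) hνdep hgdep hg'dep
      hg0 hgν hg'0 hg'1 hL hcut
  · refine ⟨ε, hε, ?_⟩
    intro X _ _ ν g g' hνdep hgdep hg'dep hg0 hgν hg'0 hg'1 hL hcut
    obtain _ | _ | k := k
    · simp only [Finset.univ_eq_empty, Finset.prod_empty, sub_self]
      rw [Finset.expect_const Finset.univ_nonempty, abs_zero]
      exact hε.le
    · simp only [Fin.prod_univ_succ, Fin.prod_univ_zero, mul_one]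
      exact (hcut 0).abs_expect_le
    · exact absurd (by omega) hk

end Literature.Combinatorics.Additive.CFZ
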